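import Literature.MathematicalPhysics.QuantumFieldTheory.Balaban1983to89.T3MinimiserStabilityReduction
import Literature.MathematicalPhysics.QuantumFieldTheory.Balaban1983to89.T3PrintedRegularMinimiser
import Literature.MathematicalPhysics.QuantumFieldTheory.Balaban1983to89.T3OrbitAverage
import Literature.MathematicalPhysics.QuantumFieldTheory.Balaban1983to89.B12ContinuousTransportInvariance
import Literature.MathematicalPhysics.QuantumFieldTheory.Balaban1983to89.Node00.CanonicalTransportOfRecord
import Summits.QuantumFields.YangMills.Theorems.FluctuationComparisonRegPrIntLWreg
import Summits.QuantumFields.YangMills.Theorems.FluctuationComparisonRegPrIntLS2BetaLaplaceInstLocal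
import Summits.QuantumFields.YangMills.Theorems.FluctuationComparisonRegPrIntLS2BetaFibreTransport
import Summits.QuantumFields.YangMills.Theorems.FluctuationComparisonRegPrIntLS2BetaFibreGrowth
import Summits.QuantumFields.YangMills.Theorems.FluctuationComparisonRegPrIntLS2BetaChartContLaplaceRows
import Summits.QuantumFields.YangMills.Theorems.FluctuationComparisonRegPrIntLS2BetaTubularChartDockTransversal
import Summits.QuantumFields.YangMills.Theorems.FluctuationComparisonRegPrIntLS2BetaResidualGaugeStabiliser
import Summits.QuantumFields.YangMills.Theorems.FluctuationComparisonRegPrIntLS2BetaPeanoSmooth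
import Summits.QuantumFields.YangMills.Theorems.FluctuationComparisonRegPrIntLS2BetaSignedCombCount
import Summits.QuantumFields.YangMills.Theorems.FluctuationComparisonRegPrIntLS2BetaLaplacePeano
import Summits.QuantumFields.YangMills.Theorems.FluctuationComparisonRegPrIntLS2BetaDecayLogDet
import Summits.QuantumFields.YangMills.Theorems.FluctuationComparisonRegPrIntLS2BetaResidualSubgroup
import Summits.QuantumFields.YangMills.Theorems.FluctuationComparisonRegPrIntLS2BetaKPLogRep
import HarnessLib

/-!
# LINE g19-2 · «LOOP LEDGER FOR H4ᶜ» — v6 (ideator seat ym-r3-idea-1, generation g19; lens «control»)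

v6 (count-neutral, additive; organ texts unchanged): §1c the GAS FORMAT (`IsLocalActivity`, `gasZ`, `KPGasOn`, `KPLogRep`, token-identical to LINE g19-1
`Lines/largefield_gas.lean` §1, CLOSED BY NAME here as there: `kpLogRep_closed : KPLogRep := …S2BetaKPLogRep.kpLogRep`, pen ym-ust-20520-w3 g15's ✓p744986) and §3d the GAS DOOR: REP and RUNG 1 in
print's raw cluster-expansion format (`BeyondOneLoopGasCan`, `LoopLedgerDepthOneGasCan`: ON THE WINDOW `f¹ = c + F₀ + log Ξ(w_·)`, `w` a KP gas of one-bond size `≤ Φ J`)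
with the knits `KPL → GAS → REP`, `KPL → GAS₁ → RUNG 1`, `GAS → GAS₁`, `SCL → KPL → GAS → H4ᶜ` PROVED — so the small-field hand and the large-field hand (LINE g19-1's LFG)
now have doors of the SAME shape (a KP gas identity on the window) and the generic combinatorics (KPL) is discharged once, by name, for both.  Sorries unchanged: 3.

v5 (count-neutral TOOL, PROVED): §1b RELOC `polymerRepOn_transport` — transport of a V-local polymer representation under a LOCAL inter-lattice map (dependency
sets `dep`, affine distance distortion `A, B`, multiplicity `D`): `PolymerRepOn W κ N f → PolymerRepOn W' κ' (D·e^{κ'B}·N) (f ∘ m)` for `κ'A ≤ κ`, `m '' W' ⊆ W` — the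
bookkeeping half of every per-step proof of REP, and the quantified reason (`C_reloc = D·e^{κ'B}`, `D ~ L³` per averaging step) why a Bałaban step must ALSO extract
flatness (the `θ^i` of the print format is coupling × extraction, not transport).  Sorries unchanged (3).

v4 (pays critic idea-crit-5 g9 #368 P1 by option (a); count-neutral in number, honest in text): THE ORGAN STUB IS NOW **REP `BeyondOneLoopRepCan` = LEDGER₀**
(«ONE small V-local polymer representation of the beyond-one-loop part `f¹ − c − F₀` on the window, norm ≤ Φ J, J·Φ J → 0, depth-uniform»), because as Lean
text the per-step LEDGER `LoopLedgerCan` is equivalent to this collapse up to `Φ ↦ Φ/(1−θ)` (critic: «the ledger dressing is INERT»; the `θ^i` sizes of a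
decomposition whose SUM alone is consumed demand nothing, and scale-indexed locality is not expressible at the datum level since the entries are born at
the FINER levels and are ultralocal at level J).  PROVED in v4: the collapse `beyondOneLoopRep_of_loopLedgerCan : LoopLedgerCan → BeyondOneLoopRepCan`, the
reduction of record `beyondOneLoopSmallCan_of_rep : SemiclassicalLimitCan → BeyondOneLoopRepCan → BeyondOneLoopSmallCan` (φ₂ J := 4 Φ J), and
`loopLedgerDepthOne_of_rep` (rung 1 = REP at K = J+1).  LEDGER stays as the documented PRINT FORMAT (not a stub).  Live sorries 3 = {EXW, GAP♯ (LINE g18-1's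
organs, restated), REP `stub_beyondOneLoopRepCan`}.  P2 (wall conserved, one bet counted once) SAID in REP's docstring; P3 superseded (SCL is PROVED from EXW +
GAP♯ since v2 — its non-degeneracy input is GAP♯ BY NAME); P4 ✓ (`oneLoopFourPtCan_eq_fourPt_oneLoopPart` kept adjacent).  No text of v1–v3 changed.

v3 (count-neutral): §3c TYPES THE FIRST RUNG `LoopLedgerDepthOneCan` (LEDGER at depth one, `K = J+1`: one constrained fluctuation integral; no sorry) and PROVES
`loopLedgerDepthOne_of_loopLedgerCan : LoopLedgerCan → LoopLedgerDepthOneCan` (specialisation) — the hands' entry signature by name.  Nothing else changed.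

v2 (count-POSITIVE for the books: one stub fewer of this line's own): **SCL `SemiclassicalLimitCan` IS NOW A THEOREM GIVEN THE ORGANS EXW and GAP♯**
(`semiclassicalLimitCan_of_organs : WindowExactness → UniformFibreGapOrbit → SemiclassicalLimitCan`, PROVED here), by the docking doors that LINE g18-1
`Lines/semiclassical_s2beta.lean` v8/v9 (w4-20520 g15, LINE OWNER WORD 12) made available: §0d restates VERBATIM from v9 the organs EXW / GAP♯ (+ `argminHist`,
`ResidualGauge`), the CHART rows / package / CHART-SMOOTH texts with CHART-SMOOTH's v9 PROOF (projection from the landed suppliers ✓`…ChartContLaplaceRows.exists_laplaceRows`,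
✓`…TubularChartDockTransversal.exists_tubularHaarChart_pivotAct_transversal`, ✓`…ResidualGaugeStabiliser`, ✓`…PeanoSmooth`), and the PROVED per-corner scaled Laplace
limit `cornerLimit_of_rows` (EXW clause 2 → GAP♯ → seam (e) ✓`…S2BetaFibreTransport` → ✓`…S2BetaLaplacePeano` → ✓`…S2BetaLaplaceInstLocal.laplaceLimit_of_charts_local`);
§3b knits the corners `V` and `1` (`1` is a window datum: `plaqSmall_one ∘ θBal_pos`, γ ≤ 1 folded into the ceiling) by ✓`…S2BetaLaplaceKnit.tendsto_log_add_fluct_of_laplaceLimit`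
— the `(dV/2)·log λ` terms are datum-independent (ONE exponent from CHART-SMOOTH) and cancel in the difference.  Live sorries 3 = {EXW `stub_windowExactness`, GAP♯
`stub_uniformFibreGapOrbit` (organs of LINE g18-1, token-identical, keyed to their seats and counted there), LEDGER `stub_loopLedgerCan` (this line's XL organ; v4: REPLACED by REP `stub_beyondOneLoopRepCan`)};
v1's `stub_semiclassicalLimitCan` is RETIRED (proved).  Texts of H4ᶜ, SCL, LEDGER and every v1 decl UNCHANGED.

Crux of record: `stmt-QuantumFields-20520` (`UnitScaleTilt.FluctuationComparisonRegPrIntL`); package of record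
`Cruxes/FluctuationComparisonRegPrIntL/Lines/runpair_organ.lean` (v15), registered input **S2β `FluctuationPartSmall`** via LINE g18-1
`Lines/semiclassical_s2beta.lean` v7 (composition 1L4ᶜ → H4ᶜ → LFR♯ᶜ → S2β PROVED there).  TARGET OF THIS LINE = the organ **H4ᶜ `BeyondOneLoopSmallCan`**
(XL; NO HAND and NO LINE before this one — g18 FINAL «OPEN after this seat»; LINE g19-1 took the other orphan LFRᶜ), restated VERBATIM in §0c together with
everything it mentions (`fourPt`, `fluctAtCan`, `oneLoopFourPtCan`, `heightDensityCan`, the §1b polymer calculus; 11 declarations, whitespace-normalised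
diff against v7 = IDENTICAL); closure is BY TEXT (the farm cannot import `Cruxes/…/Lines/*.lean`).

THE CONTROL TABLE (lens «control»: the controlling quantities are the PER-STEP POLYMER NORMS of the beyond-one-loop entries of the effective action, one per
renormalization step, at the PHYSICAL coupling — Bałaban's own ledger `Σ_j E^{(j)}` ([Balaban1987RG1] (0.23)–(0.26)) — and the new OBJECT is the one-loop part
`F₀` as a DEFINED limit, which removes every `∃ F₀` hand-over between stubs):

* **`oneLoopPartCan` (DEFINED)**: `F₀(V) := lim_{λ→∞} (f^λ(V) − f^λ(1))`, the pointwise semiclassical limit of the λ-scaled fluctuation part normalised at the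
  flat field (`limUnder`; junk where the limit fails).
* **SCL `SemiclassicalLimitCan`** (stub, M, HAND-READY for the LAPLACE hands w4/w5-20520): on the window the limit defining `F₀` EXISTS — pointwise in `V`, at
  FIXED lattices `J ≤ K`, fixed family `F`, fixed history windows `θBal(γ)`; no uniformity asked.  It is Laplace's method for the RATIO of two fibre integrals
  (classical factors removed by the `β_K·minActionRegPr` term of `f^λ`), minima along residual-gauge orbits of equal dimension, interior to the sharp windows —
  the continuation of the tree's orbit-Laplace theorems.  PROVED from it: `Λ₄ := oneLoopFourPtCan = fourPt F₀` on window quadruples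
  (`oneLoopFourPtCan_eq_fourPt_oneLoopPart`): H4ᶜ's `limUnder` is IDENTIFIED, not assumed.
* **LEDGER `LoopLedgerCan`** (organ stub, XL): same prefix as H4ᶜ plus a per-step contraction factor `θ ∈ (0,1)` chosen with `κ`; for every run `K` and height
  `J ≤ K`, ON THE WINDOW the pointwise identity `f^1 = c + F₀ + Σ_{i<K−J} R_i`, the step-`i` remainder `R_i` (renormalization step `J+1+i`) having a V-local
  polymer representation at rate `κ` of norm `≤ Φ J · θ^i`, `J·Φ J → 0`, depth-uniform.  Print: `A_k = −(1/g_k²)A(U_k) + Σ_j [−β_j A(U_k) + E^{(j)}(U_k)]`,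
  `E^{(j)} = Σ_{X∈D_j} E^{(j)}(X, ·)` localized, analytic, `|E^{(j)}(X,U)| ≤ E₀ e^{−κ d_j(X)}` ([Balaban1987RG1] (0.22)–(0.26) pp.256–257, d = 4); d = 3:
  [Balaban1985UV3] (41)–(46) pp.266–267, the per-step sum `Σ_j Σ_{Y_j} 𝒫_j g_j² ξ_{L^{−j}}` and «each renormalization transformation … decreases by the factor
  L^{−2n} ≤ L^{−4}», «n ≥ 2 plays a crucial role» — whence `θ`; the entries are the terms beyond the Gaussian approximation of the `j`-th fluctuation
  integral (loop parameter `g_j² = γL^{−j}`, superrenormalisable) plus that step's sharp-constraint tails — whence `J·Φ J → 0`.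
* **PROVED**: the polymer-representation ALGEBRA (`polymerRepOn_mono`, `polymerRepOn_add` by concatenation of polymer systems `Fin.append` /
  `Fin.sum_univ_add`, `polymerRepOn_finset_sum`), the geometric budget `Σ_{i<n} Φ θ^i ≤ Φ/(1−θ)` (`ledger_budget_le`), and the reduction
  `beyondOneLoopSmallCan_of_ledger : SemiclassicalLimitCan → LoopLedgerCan → BeyondOneLoopSmallCan` with `φ₂ J := 4 Φ J/(1 − θ)` (thresholds merged by
  `max`/`min`; the summed ledger is ONE representation, its connected 4-points are κ-clustered by the PROVED `fourPoint_le_of_polymerRepOn`).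

WHY THIS CUT (and not the census's dead H4 attempts): #FTC-in-λ / Helffer–Sjöstrand (cone II), «finite-dimensional Laplace remainder» (no depth-uniformity),
«one λ-uniform polymer rep of f^λ − F₀» (LINE g17-1's SFN with a λ: a variant), #147 «dyadic ℏ-ladder: an index, not a reduction».  Here (a) the λ → ∞ side is
cut DOWN to a pointwise, fixed-lattice Laplace statement a hand can prove now (SCL), and the identification `Λ₄ = Δ²F₀` is PROVED from it; (b) the size side is
stated ONLY at the physical coupling `λ = 1` and PER STEP — each rung `i` is a distinct printed object (`E^{(J+1+i)}`, one fluctuation integral's non-Gaussian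
part in a unit-gap regular background, GAP♯'s regime) with its own mechanism (`θ^i`: the n ≥ 2 irrelevance per step; `Φ J`: `g_J²`), and the SUM over rungs is
PROVED here, not asserted; (c) no `∃`-sharing (census #126): the two stubs meet only in the DEFINED `oneLoopPartCan`.

Sorries (v4) = {EXW `stub_windowExactness`, GAP♯ `stub_uniformFibreGapOrbit` (LINE g18-1's organs, restated, counted there), REP `stub_beyondOneLoopRepCan` (XL, this
line's organ = LEDGER₀)}; 0 elsewhere (v1 had {LEDGER, SCL}; SCL is proved in §3b; LEDGER collapses to REP, proved in §3).  No summit is proved by a line;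
`YM3TorusSU2` is NOT proved (the package's other inputs S1a, 26243, S2α′, O1 and S2β's other organs EXW, GAP♯, LAPLACE/1L4ᶜ, LFRᶜ stay open); nothing of
Bałaban's asserted.
-/

noncomputable section

noncomputable section

open MeasureTheory Filter Topology Set
open Literature.MathematicalPhysics.QuantumFieldTheory.Balaban1983to89
open Literature.MathematicalPhysics.QuantumFieldTheory.Balaban1983to89.T3ContinuumYM3Torus
open Literature.MathematicalPhysics.QuantumFieldTheory.Balaban1983to89.T3NestedUnitLaws
open Literature.MathematicalPhysics.QuantumFieldTheory.Balaban1983to89.T3UnitLawDensityEML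
open Literature.MathematicalPhysics.QuantumFieldTheory.Balaban1983to89.T3UnitScaleTilt
open Literature.MathematicalPhysics.QuantumFieldTheory.Balaban1983to89.T3TiltDescent
open Literature.MathematicalPhysics.QuantumFieldTheory.Balaban1983to89.T3PrintedRegularMinimiser
open Literature.MathematicalPhysics.QuantumFieldTheory.Balaban1983to89.T3ConstrainedMinimiser (fibre)
open Literature.MathematicalPhysics.QuantumFieldTheory.Balaban1983to89.T3LevelShift
open Literature.MathematicalPhysics.QuantumFieldTheory.Balaban1983to89.Missing
open Literature.MathematicalPhysics.QuantumFieldTheory.Balaban1983to89.T4Continuum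
open scoped Literature.MathematicalPhysics.QuantumFieldTheory.Balaban1983to89.T3OrbitAverage

namespace Summit.QuantumFields.YangMills.Cruxes.FluctuationComparisonRegPrIntL.RunPairOrgan.LoopLedger

/-! ## §0a The canonical version of the restricted height density (verbatim from LINE g18-1 `Lines/semiclassical_s2beta.lean` v7 §1) -/

section Canonical

variable (F : T3Family) (γ : ℝ) {J K : ℕ} (hJK : J ≤ K) (S : Set (GaugeField (F.P K) 0 (Matrix.specialUnitaryGroup (Fin 2) ℂ)))

/-- **THE CANONICAL VERSION OF BAŁABAN'S RESTRICTED DENSITY AT HEIGHT `K − J`** read on the `J`-th tower's finest lattice: the trunk's `heightDensity`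
(a chosen Radon–Nikodym version) replaced by `Node00.canonVersion` of its a.e.-class for product Haar — continuous on the maximal open set carrying a
continuous representative and equal there to every such representative. [cite: Balaban1985UV3, (2) p.256 and (41) p.266] -/
def heightDensityCan (V : GaugeField (F.P J) 0 (Matrix.specialUnitaryGroup (Fin 2) ℂ)) : ℝ :=
  Node00.canonVersion (fieldMeasure (F.P J) 0 (Matrix.specialUnitaryGroup (Fin 2) ℂ)) (heightDensity F γ hJK S) V

end Canonical

/-! ## §0b Polymer calculus (verbatim from LINE g18-1 `Lines/semiclassical_s2beta.lean` v7 §1b = LINE g17-1 `Lines/polymer_norm_s2beta.lean`): V-local activity systems, the weighted norm, the PROVED 4-point clustering -/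

section PolymerCalculus

variable {P : Params} {G : Type*} {n : ℕ}

/-- **V-LOCALITY**: the activity of polymer `X` depends on the window field only through the bonds of its support `supp X`
([Balaban1987RG1] (0.22) «E(X, ·) depends on the field restricted to X»). [cite: Balaban1987RG1, (0.22)] -/
def IsLocal (supp : Fin n → Finset (PBond P 0)) (act : Fin n → GaugeField P 0 G → ℝ) : Prop :=
  ∀ X (U U' : GaugeField P 0 G), (∀ e ∈ supp X, U e = U' e) → act X U = act X U'

open Classical in
/-- **A V-LOCAL POLYMER REPRESENTATION OF `f` ON THE WINDOW `W` WITH WEIGHTED NORM `≤ N` AT RATE `κ`**: finitely many polymers `X` with bond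
supports, lengths `len X ≥` the source-distance diameter of the support, weights `wt X ≥ sup_W |act X|`, the exponentially weighted norm
`sup_b Σ_{X ∋ b} wt X · e^{κ·len X} ≤ N`, and the IDENTITY `f = c + Σ_X act X` on `W` ([Balaban1987RG1] (0.21)–(0.26); the norm is the
`‖·‖_κ` of [Brydges1986] §3 / Dimock arXiv:1108.1335 (38)). [cite: Balaban1987RG1, (0.23)-(0.26)] -/
def PolymerRepOn (W : Set (GaugeField P 0 G)) (κ N : ℝ) (f : GaugeField P 0 G → ℝ) : Prop :=
  ∃ (n : ℕ) (supp : Fin n → Finset (PBond P 0)) (len wt : Fin n → ℝ) (act : Fin n → GaugeField P 0 G → ℝ) (c : ℝ),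
    IsLocal supp act ∧ (∀ X, 0 ≤ wt X) ∧
    (∀ X, ∀ e ∈ supp X, ∀ e' ∈ supp X, (e.src.tdist e'.src : ℝ) ≤ len X) ∧
    (∀ X U, U ∈ W → |act X U| ≤ wt X) ∧
    (∀ e : PBond P 0, ∑ X ∈ Finset.univ.filter (fun X => e ∈ supp X), wt X * Real.exp (κ * len X) ≤ N) ∧
    ∀ U, U ∈ W → f U = c + ∑ X, act X U

open Classical in
/-- **PC · POLYMER NORM ⇒ κ-CLUSTERED CONNECTED 4-POINTS (PROVED)**: under the four one-bond window moves of S2β at bonds `b, b′`, the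
polymers whose support misses `b` or misses `b′` cancel EXACTLY by V-locality; each survivor contributes `≤ 4·wt X ≤ 4·wt X·e^{κ len X}·e^{−κ·tdist(b,b′)}`
(`len X ≥ tdist`), and the weighted norm sums them: `|Δ_bΔ_{b′}(c + Σ act)| ≤ 4N·e^{−κ·tdist(b,b′)}`. [cite: Balaban1987RG1, (0.23)-(0.26)] -/
theorem fourPoint_le_of_polymerNorm (W : Set (GaugeField P 0 G)) (supp : Fin n → Finset (PBond P 0)) (len wt : Fin n → ℝ)
    (act : Fin n → GaugeField P 0 G → ℝ) (κ N c : ℝ) (hκ : 0 ≤ κ) (hloc : IsLocal supp act) (hwt : ∀ X, 0 ≤ wt X)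
    (hdiam : ∀ X, ∀ e ∈ supp X, ∀ e' ∈ supp X, (e.src.tdist e'.src : ℝ) ≤ len X)
    (hbd : ∀ X U, U ∈ W → |act X U| ≤ wt X)
    (hcov : ∀ e : PBond P 0, ∑ X ∈ Finset.univ.filter (fun X => e ∈ supp X), wt X * Real.exp (κ * len X) ≤ N)
    (b b' : PBond P 0) (U V Y Z : GaugeField P 0 G) (hU : U ∈ W) (hV : V ∈ W) (hY : Y ∈ W) (hZ : Z ∈ W)
    (hUV : ∀ e, e ≠ b → U e = V e) (hUY : ∀ e, e ≠ b' → U e = Y e) (hVZ : ∀ e, e ≠ b' → V e = Z e)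
    (hYZ : ∀ e, e ≠ b → Y e = Z e) :
    |((c + ∑ X, act X U) - (c + ∑ X, act X V)) - ((c + ∑ X, act X Y) - (c + ∑ X, act X Z))|
      ≤ 4 * N * Real.exp (-(κ * (b.src.tdist b'.src : ℝ))) := by
  set d : ℝ := (b.src.tdist b'.src : ℝ) with hd
  have hT : ((c + ∑ X, act X U) - (c + ∑ X, act X V)) - ((c + ∑ X, act X Y) - (c + ∑ X, act X Z))
      = ∑ X, ((act X U - act X V) - (act X Y - act X Z)) := by
    simp only [Finset.sum_sub_distrib]; ring
  rw [hT]
  have hpt : ∀ X, |(act X U - act X V) - (act X Y - act X Z)|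
      ≤ if b ∈ supp X then 4 * (wt X * Real.exp (κ * len X)) * Real.exp (-(κ * d)) else 0 := by
    intro X
    by_cases hb : b ∈ supp X
    · rw [if_pos hb]
      by_cases hb' : b' ∈ supp X
      · have hdle : d ≤ len X := hdiam X b hb b' hb'
        have hkey : wt X ≤ wt X * Real.exp (κ * len X) * Real.exp (-(κ * d)) := by
          rw [mul_assoc, ← Real.exp_add]
          have h0 : 0 ≤ κ * len X + -(κ * d) := by nlinarith
          calc wt X = wt X * 1 := (mul_one _).symm
            _ ≤ wt X * Real.exp (κ * len X + -(κ * d)) := mul_le_mul_of_nonneg_left (Real.one_le_exp h0) (hwt X)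
        have h1 := abs_le.mp (hbd X U hU)
        have h2 := abs_le.mp (hbd X V hV)
        have h3 := abs_le.mp (hbd X Y hY)
        have h4 := abs_le.mp (hbd X Z hZ)
        have h5 : |(act X U - act X V) - (act X Y - act X Z)| ≤ 4 * wt X :=
          abs_le.mpr ⟨by linarith [h1.1, h2.2, h3.2, h4.1], by linarith [h1.2, h2.1, h3.1, h4.2]⟩
        calc |(act X U - act X V) - (act X Y - act X Z)| ≤ 4 * wt X := h5
          _ ≤ 4 * (wt X * Real.exp (κ * len X) * Real.exp (-(κ * d))) := by linarith
          _ = 4 * (wt X * Real.exp (κ * len X)) * Real.exp (-(κ * d)) := by ring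
      · have e1 : act X U = act X Y := hloc X U Y (fun e he => hUY e (fun h => hb' (h ▸ he)))
        have e2 : act X V = act X Z := hloc X V Z (fun e he => hVZ e (fun h => hb' (h ▸ he)))
        have hw := hwt X
        rw [e1, e2]
        simp only [sub_self, abs_zero]
        positivity
    · rw [if_neg hb]
      have e1 : act X U = act X V := hloc X U V (fun e he => hUV e (fun h => hb (h ▸ he)))
      have e2 : act X Y = act X Z := hloc X Y Z (fun e he => hYZ e (fun h => hb (h ▸ he)))
      rw [e1, e2]
      simp only [sub_self, abs_zero, le_refl]
  calc |∑ X, ((act X U - act X V) - (act X Y - act X Z))|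
      ≤ ∑ X, |(act X U - act X V) - (act X Y - act X Z)| := Finset.abs_sum_le_sum_abs _ _
    _ ≤ ∑ X, (if b ∈ supp X then 4 * (wt X * Real.exp (κ * len X)) * Real.exp (-(κ * d)) else 0) :=
        Finset.sum_le_sum (fun X _ => hpt X)
    _ = (∑ X ∈ Finset.univ.filter (fun X => b ∈ supp X), wt X * Real.exp (κ * len X)) * (4 * Real.exp (-(κ * d))) := by
        rw [Finset.sum_filter, Finset.sum_mul]
        refine Finset.sum_congr rfl (fun X _ => ?_)
        split_ifs <;> ring
    _ ≤ N * (4 * Real.exp (-(κ * d))) := by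
        have h4 : 0 ≤ 4 * Real.exp (-(κ * d)) := by positivity
        exact mul_le_mul_of_nonneg_right (hcov b) h4
    _ = 4 * N * Real.exp (-(κ * d)) := by ring

/-- **PC in representation form**: a function with a V-local polymer representation of norm `≤ N` at rate `κ ≥ 0` on `W` has κ-clustered
connected 4-points `≤ 4N e^{−κ·tdist(b,b′)}` under the four one-bond moves inside `W`. [cite: Balaban1987RG1, (0.23)-(0.26)] -/
theorem fourPoint_le_of_polymerRepOn {W : Set (GaugeField P 0 G)} {κ N : ℝ} {f : GaugeField P 0 G → ℝ}
    (h : PolymerRepOn W κ N f) (hκ : 0 ≤ κ)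
    (b b' : PBond P 0) (U V Y Z : GaugeField P 0 G) (hU : U ∈ W) (hV : V ∈ W) (hY : Y ∈ W) (hZ : Z ∈ W)
    (hUV : ∀ e, e ≠ b → U e = V e) (hUY : ∀ e, e ≠ b' → U e = Y e) (hVZ : ∀ e, e ≠ b' → V e = Z e)
    (hYZ : ∀ e, e ≠ b → Y e = Z e) :
    |(f U - f V) - (f Y - f Z)| ≤ 4 * N * Real.exp (-(κ * (b.src.tdist b'.src : ℝ))) := by
  obtain ⟨n, supp, len, wt, act, c, hloc, hwt, hdiam, hbd, hcov, hrep⟩ := h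
  rw [hrep U hU, hrep V hV, hrep Y hY, hrep Z hZ]
  exact fourPoint_le_of_polymerNorm W supp len wt act κ N c hκ hloc hwt hdiam hbd hcov b b' U V Y Z hU hV hY hZ hUV hUY hVZ hYZ

open Classical in
/-- **NORM ZERO ⇒ the trivial representation**: a function constant on `W` has a polymer representation of norm `0` (no polymers) — the
sanity instance showing the predicate is inhabited exactly by what it should be at norm zero. [cite: Balaban1987RG1, (0.23)-(0.26)] -/
theorem polymerRepOn_of_const (W : Set (GaugeField P 0 G)) (κ c : ℝ) (f : GaugeField P 0 G → ℝ) (hf : ∀ U, U ∈ W → f U = c) :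
    PolymerRepOn W κ 0 f := by
  refine ⟨0, Fin.elim0, Fin.elim0, Fin.elim0, Fin.elim0, c, ?_, ?_, ?_, ?_, ?_, ?_⟩
  · intro X; exact Fin.elim0 X
  · intro X; exact Fin.elim0 X
  · intro X; exact Fin.elim0 X
  · intro X; exact Fin.elim0 X
  · intro e; exact (Finset.sum_eq_zero fun X _ => Fin.elim0 X).le
  · intro U hU; simp [hf U hU]

end PolymerCalculus

/-! ## §0c The λ-scaled fluctuation part, the canonical one-loop 4-point and the TARGET organ H4ᶜ (verbatim from LINE g18-1 `Lines/semiclassical_s2beta.lean` v7 §2) -/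

section Rows

/-- The connected 4-point (mixed second difference) — verbatim from v3a. [cite: Balaban1985UV3, (41) p.266] -/
def fourPt {X : Type*} (f : X → ℝ) (U V W Z : X) : ℝ := (f U - f V) - (f W - f Z)

variable (F : T3Family) (γ b₀ p₀ ε₀ : ℝ) {J K : ℕ} (hJK : J ≤ K)

/-- **THE λ-SCALED FLUCTUATION PART OVER THE CANONICAL VERSION** `f^λ(V) := log heightDensityCan F (γ/λ) (histGood at θBal(γ)) V + β_K(γ/λ)·minActionRegPr(V)`.
[cite: Balaban1985UV3, (2) p.256 and (41) p.266] -/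
def fluctAtCan (lam : ℝ) (V : GaugeField (F.P J) 0 (Matrix.specialUnitaryGroup (Fin 2) ℂ)) : ℝ :=
  Real.log (heightDensityCan F (γ / lam) hJK (histGood F ℰp (θBal F.L γ b₀ p₀) K J) V)
    + (F.scheme ℰp (γ / lam)).β K * minActionRegPr F J K hJK ε₀ V

/-- **THE CANONICAL ONE-LOOP 4-POINT** `Λ₄ := lim_{λ→∞} Δ² f^λ` over the canonical version (junk if the limit does not exist; 1L4ᶜ asserts it does).
[cite: Balaban1985Variational, Thm 1 (8)-(10) p.279] -/
def oneLoopFourPtCan (U V W Z : GaugeField (F.P J) 0 (Matrix.specialUnitaryGroup (Fin 2) ℂ)) : ℝ :=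
  limUnder atTop (fun lam : ℝ => fourPt (fluctAtCan F γ b₀ p₀ ε₀ hJK lam) U V W Z)

/-- At `λ = 1`: S2β's integrand with the canonical small-history density. [cite: Balaban1985UV3, (41) p.266] -/
theorem fluctAtCan_one (V : GaugeField (F.P J) 0 (Matrix.specialUnitaryGroup (Fin 2) ℂ)) :
    fluctAtCan F γ b₀ p₀ ε₀ hJK 1 V =
      Real.log (heightDensityCan F γ hJK (histGood F ℰp (θBal F.L γ b₀ p₀) K J) V)
        + (F.scheme ℰp γ).β K * minActionRegPr F J K hJK ε₀ V := by
  simp only [fluctAtCan, div_one]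

/-- Whenever the λ-scaled 4-point has SOME limit `a`, the canonical one-loop 4-point equals it. [cite: Balaban1985Variational, Thm 1 (8) p.279] -/
theorem oneLoopFourPtCan_eq_of_tendsto (U V W Z : GaugeField (F.P J) 0 (Matrix.specialUnitaryGroup (Fin 2) ℂ)) {a : ℝ}
    (h : Tendsto (fun lam : ℝ => fourPt (fluctAtCan F γ b₀ p₀ ε₀ hJK lam) U V W Z) atTop (𝓝 a)) :
    oneLoopFourPtCan F γ b₀ p₀ ε₀ hJK U V W Z = a := by
  unfold oneLoopFourPtCan; exact h.limUnder_eq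


/-- **H4ᶜ · BEYOND ONE LOOP, OVER THE CANONICAL VERSION** (re-typing of v3a's `BeyondOneLoopSmall`): the `λ = 1` connected 4-point of `f^λ` differs from its
semiclassical limit by a κ-clustered `≤ φ₂ J`, `J·φ₂ J → 0`, depth-uniform. [cite: Balaban1985UV3, (45)-(47) p.267; Balaban1987RG1, Thm 1 (0.19)-(0.26)] -/
def BeyondOneLoopSmallCan : Prop :=
  ∀ (L : ℕ), ∃ pS : ℝ, ∀ (b₀ p₀ : ℝ), 0 < b₀ → pS ≤ p₀ → 0 < p₀ → ∃ ε₁ : ℝ, 0 < ε₁ ∧ ∀ (ε₀ : ℝ), 0 < ε₀ → ε₀ ≤ ε₁ →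
    ∃ γ₁ : ℝ, 0 < γ₁ ∧ ∃ κ : ℝ, 0 < κ ∧ ∀ (F : T3Family) (γ : ℝ), F.L = L → 0 < γ → γ ≤ γ₁ →
      ∃ φ₂ : ℕ → ℝ, (∀ J, 0 ≤ φ₂ J) ∧ Tendsto (fun J : ℕ => (J : ℝ) * φ₂ J) atTop (𝓝 0) ∧
        ∀ (J K : ℕ) (hJK : J ≤ K) (b b' : PBond (F.P J) 0) (U V W Z : GaugeField (F.P J) 0 (Matrix.specialUnitaryGroup (Fin 2) ℂ)),
          PlaqSmall (θBal F.L γ b₀ p₀ J) U → PlaqSmall (θBal F.L γ b₀ p₀ J) V →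
          PlaqSmall (θBal F.L γ b₀ p₀ J) W → PlaqSmall (θBal F.L γ b₀ p₀ J) Z →
          (∀ e, e ≠ b → U e = V e) → (∀ e, e ≠ b' → U e = W e) → (∀ e, e ≠ b' → V e = Z e) → (∀ e, e ≠ b → W e = Z e) →
          |fourPt (fluctAtCan F γ b₀ p₀ ε₀ hJK 1) U V W Z - oneLoopFourPtCan F γ b₀ p₀ ε₀ hJK U V W Z|
            ≤ φ₂ J * Real.exp (-(κ * (b.src.tdist b'.src : ℝ)))

end Rows

/-! ## §0d DOCKING RESTATEMENTS (v2; VERBATIM from LINE g18-1 `Lines/semiclassical_s2beta.lean` v9 §3 / §4b / §5 — w4-20520 g15's docking edition): the organs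
EXW / GAP♯ (token-identical texts, with `argminHist`, `ResidualGauge`), the CHART rows / package / CHART-SMOOTH (token-identical) with CHART-SMOOTH's v9 PROOF
(renamed `chartSmooth_docked`; body verbatim), and the PROVED per-corner scaled Laplace limit `cornerLimit_of_rows` (verbatim) -/

section Organs

/-- **EXW · WINDOW-WIDE EXACTNESS** — VERBATIM from v3a (organ G-K1aR-2; version-free: it speaks of `fibre`, `histGood`, `regFibrePr`, `minActionRegPr` only).
[cite: Balaban1985Variational, Thm 1 (8) p.279 and Prop 7 p.299] -/
def WindowExactness : Prop :=
  ∀ (L : ℕ), ∃ pS : ℝ, ∀ (b₀ p₀ : ℝ), 0 < b₀ → pS ≤ p₀ → 0 < p₀ → ∃ ε₁ : ℝ, 0 < ε₁ ∧ ∀ (ε₀ : ℝ), 0 < ε₀ → ε₀ ≤ ε₁ →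
    ∃ γ₁ : ℝ, 0 < γ₁ ∧ ∀ (F : T3Family) (γ : ℝ), F.L = L → 0 < γ → γ ≤ γ₁ →
      ∀ (J K : ℕ) (hJK : J ≤ K) (V : GaugeField (F.P J) 0 (Matrix.specialUnitaryGroup (Fin 2) ℂ)), PlaqSmall (θBal F.L γ b₀ p₀ J) V →
        (∀ U ∈ fibre F ℰp J K hJK V, U ∈ histGood F ℰp (θBal F.L γ b₀ p₀) K J →
            minActionRegPr F J K hJK ε₀ V ≤ wilsonAction4 U) ∧
        (∃ U₀ ∈ regFibrePr F J K hJK ε₀ V, U₀ ∈ histGood F ℰp (θBal F.L γ b₀ p₀) K J ∧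
            wilsonAction4 U₀ = minActionRegPr F J K hJK ε₀ V)

/-- The set of action-minimising small-field histories over a datum — VERBATIM from v3a. [cite: Balaban1985Variational, Thm 1 (8) p.279] -/
def argminHist (F : T3Family) (γ b₀ p₀ ε₀ : ℝ) {J K : ℕ} (hJK : J ≤ K) (V : GaugeField (F.P J) 0 (Matrix.specialUnitaryGroup (Fin 2) ℂ)) :
    Set (GaugeField (F.P K) 0 (Matrix.specialUnitaryGroup (Fin 2) ℂ)) :=
  {U' | U' ∈ fibre F ℰp J K hJK V ∧ U' ∈ histGood F ℰp (θBal F.L γ b₀ p₀) K J ∧ wilsonAction4 U' = minActionRegPr F J K hJK ε₀ V}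

/-- **THE RESIDUAL GAUGE GROUP of the `(K−J)`-fold averaging fibration** (v6; ORBIT flag of w4-20520 g15 17:00Z): the fine gauge transformations `w` that act
trivially on data, `D_{J,K}(U^w) = D_{J,K}(U)` for every fine `U` — by the covariance (11) of the averaging (0.4) these are the `w` whose induced coarse
transformation `w̄ = w ∘ emb^{K−J}` is central-constant (`≡ ±1` on `SU(2)`; both sheets act identically since `(−w)•U = w•U`).  It contains `1`
(`one_mem_residualGauge`), preserves every fibre, the Wilson action (`T4WilsonGaugeFlatDirection.wilsonAction_gaugeAct`) and `histGood`, and acts FREELY on fine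
fields (a `w` fixing `U` is determined by parallel transport from one embedded site, where `w = 1`), so every residual orbit has the SAME dimension — the source
of the datum-independence of the `−(n/2)·log λ` term in (T), including at `V ≡ 1` where `argmin = {du : ū ≡ c} = {w•1 : w̄ ≡ 1}` (`u·c⁻¹` is residual).
[cite: Balaban1985Averaging, (8) p.19 and (11) p.19; Balaban1985Variational, Thm 1 (8)-(10) p.279] -/
def ResidualGauge (F : T3Family) {J K : ℕ} (hJK : J ≤ K) : Set (GaugeTransf (F.P K) 0 (Matrix.specialUnitaryGroup (Fin 2) ℂ)) :=
  {w | ∀ U : GaugeField (F.P K) 0 (Matrix.specialUnitaryGroup (Fin 2) ℂ),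
    descendTo F ℰp J K hJK (GaugeField.gaugeAct w U) = descendTo F ℰp J K hJK U}

/-- `w ≡ 1` is residual (so the orbit infimum in GAP♯ is over a nonempty type). [cite: Balaban1985Averaging, (8) p.19] -/
theorem one_mem_residualGauge (F : T3Family) {J K : ℕ} (hJK : J ≤ K) : (fun _ => 1) ∈ ResidualGauge F hJK := by
  intro U
  have h : GaugeField.gaugeAct (fun _ => (1 : Matrix.specialUnitaryGroup (Fin 2) ℂ)) U = U := by
    funext b; simp [GaugeField.gaugeAct]
  rw [h]

/-- **GAP♯ · UNIFORM FIBRE STIFFNESS, ORBIT FORM** (v6 — replaces GAP as LAPLACE's hypothesis; ORBIT flag w4-20520 g15 17:00Z, LINE OWNER WORD 6): GAP's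
prefix VERBATIM, but the excess action over the window controls the squared distance to the RESIDUAL-GAUGE ORBIT of ANY minimising small-field history `U₀`,
not merely the distance to the argmin set.  Consequences: ORB («`argminHist V` is ONE residual orbit» — take `U ∈ argminHist V`: the infimum vanishes and the
orbit is compact) and, `histGood` and the action being gauge invariant, GAP itself; this is the Morse–Bott input (a non-degenerate critical ORBIT of
datum-independent dimension) that `Literature.Analysis.Asymptotics.LaplaceMethodOrbitCompact` consumes.  It is the natural output of the stiffness seats
(Hessian gap transverse to the gauge orbit at print's minimiser, [Balaban1985Variational] (142), propagated along the fibre by convexity) together with the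
UNIQUENESS half of CMP 102 Thm 1.  Why it might fail: a window datum with two gauge-inequivalent minimising small-field histories (excluded in print by the
contraction argument of CMP 102 Thm 1 for small fields — exactly what GAP♯ adds over GAP); cheapest falsifier: two distinct residual orbits of minimisers over
`V ≡ 1` at depth 1, `L = 3` (there are none: the minimisers are the pure gauges `du`, `ū` constant, one residual orbit).
[cite: Balaban1985Variational, Thm 1 (8)-(10) p.279 and (142) p.299; Balaban1984PropagatorsII, (1.33)] -/
def UniformFibreGapOrbit : Prop :=
  ∀ (L : ℕ), ∃ pS : ℝ, ∀ (b₀ p₀ : ℝ), 0 < b₀ → pS ≤ p₀ → 0 < p₀ → ∃ ε₁ : ℝ, 0 < ε₁ ∧ ∀ (ε₀ : ℝ), 0 < ε₀ → ε₀ ≤ ε₁ →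
    ∃ γ₁ : ℝ, 0 < γ₁ ∧ ∃ μ : ℝ, 0 < μ ∧ ∀ (F : T3Family) (γ : ℝ), F.L = L → 0 < γ → γ ≤ γ₁ →
      ∀ (J K : ℕ) (hJK : J ≤ K) (V : GaugeField (F.P J) 0 (Matrix.specialUnitaryGroup (Fin 2) ℂ)), PlaqSmall (θBal F.L γ b₀ p₀ J) V →
        ∀ U₀ ∈ argminHist F γ b₀ p₀ ε₀ hJK V, ∀ U ∈ fibre F ℰp J K hJK V, U ∈ histGood F ℰp (θBal F.L γ b₀ p₀) K J →
          μ * ((F.L : ℝ)⁻¹) ^ (2 * (K - J)) *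
              (⨅ w : ResidualGauge F hJK, ∑ ℓ : PBond (F.P K) 0,
                dist1 (U ℓ * ((GaugeField.gaugeAct (w : GaugeTransf (F.P K) 0 (Matrix.specialUnitaryGroup (Fin 2) ℂ)) U₀) ℓ)⁻¹) ^ 2)
            ≤ wilsonAction4 U - minActionRegPr F J K hJK ε₀ V

end Organs

section LaplaceDocking

variable (F : T3Family) (γ b₀ p₀ ε₀ : ℝ) {J K : ℕ} (hJK : J ≤ K)

/-- **THE CHART ROWS** (text = the per-datum conjuncts of CHART∞ V-c3 `…ChartContLaplaceRows.exists_laplaceRows` (w3-20520 g14, sha16 f6c6b279) that the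
LIMIT door and px11 g10's seam (e) `…S2BetaFibreTransport.limitInst_exw_gap_rows_of_chartRows` read, for a window chart `c` on the whole `θ_J`-window with
carrier `Xc V := {z | c.jac (V,z) ≠ 0}` and the action `pivotAct` of `residualSubgroup × SU(2)^{pivots}`): compact invariant carrier, vanishing of the density off
it, continuity of the action-through-the-chart ∕ the density ∕ the chart on it, invariances, relative openness of the event, identity off the pivots and the fibre
identity on the carrier, and RECOGNITION of fibre points in `histGood` as live self-charted points. [cite: Balaban1985Averaging, §E Prop 6 p.26-27; Balaban1987RG1, (0.13) p.254] -/
def ChartRows (c : Summit.QuantumFields.YangMills.Theorems.FluctuationComparisonRegPrIntLWregGlue.WindowChart F hJK (histGood F ℰp (θBal F.L γ b₀ p₀) K J) {V : GaugeField (F.P J) 0 (Matrix.specialUnitaryGroup (Fin 2) ℂ) | PlaqSmall (θBal F.L γ b₀ p₀ J) V}) : Prop :=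
  ∀ V : GaugeField (F.P J) 0 (Matrix.specialUnitaryGroup (Fin 2) ℂ),
    IsCompact {z : GaugeField (F.P K) 0 (Matrix.specialUnitaryGroup (Fin 2) ℂ) | c.jac (V, z) ≠ 0} ∧
    (∀ k z, z ∈ {z : GaugeField (F.P K) 0 (Matrix.specialUnitaryGroup (Fin 2) ℂ) | c.jac (V, z) ≠ 0} → Summit.QuantumFields.YangMills.Theorems.FluctuationComparisonRegPrIntLS2BetaResidualSubgroup.pivotAct F hJK (Summit.QuantumFields.YangMills.Theorems.FluctuationComparisonRegPrIntLWregChain.iterCentralBond (P := F.P K) (K - J)) k z ∈ {z : GaugeField (F.P K) 0 (Matrix.specialUnitaryGroup (Fin 2) ℂ) | c.jac (V, z) ≠ 0}) ∧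
    (∀ z, z ∉ {z : GaugeField (F.P K) 0 (Matrix.specialUnitaryGroup (Fin 2) ℂ) | c.jac (V, z) ≠ 0} → (c.jac (V, z) : ℝ) = 0) ∧
    ContinuousOn (fun z => wilsonAction4 (c.Φ (V, z))) {z : GaugeField (F.P K) 0 (Matrix.specialUnitaryGroup (Fin 2) ℂ) | c.jac (V, z) ≠ 0} ∧
    ContinuousOn (fun z => (c.jac (V, z) : ℝ)) {z : GaugeField (F.P K) 0 (Matrix.specialUnitaryGroup (Fin 2) ℂ) | c.jac (V, z) ≠ 0} ∧
    ContinuousOn (fun z => c.Φ (V, z)) {z : GaugeField (F.P K) 0 (Matrix.specialUnitaryGroup (Fin 2) ℂ) | c.jac (V, z) ≠ 0} ∧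
    (∀ k, ∀ z ∈ {z : GaugeField (F.P K) 0 (Matrix.specialUnitaryGroup (Fin 2) ℂ) | c.jac (V, z) ≠ 0}, wilsonAction4 (c.Φ (V, Summit.QuantumFields.YangMills.Theorems.FluctuationComparisonRegPrIntLS2BetaResidualSubgroup.pivotAct F hJK (Summit.QuantumFields.YangMills.Theorems.FluctuationComparisonRegPrIntLWregChain.iterCentralBond (P := F.P K) (K - J)) k z)) = wilsonAction4 (c.Φ (V, z))) ∧
    (∀ k, ∀ z ∈ {z : GaugeField (F.P K) 0 (Matrix.specialUnitaryGroup (Fin 2) ℂ) | c.jac (V, z) ≠ 0}, (c.jac (V, Summit.QuantumFields.YangMills.Theorems.FluctuationComparisonRegPrIntLS2BetaResidualSubgroup.pivotAct F hJK (Summit.QuantumFields.YangMills.Theorems.FluctuationComparisonRegPrIntLWregChain.iterCentralBond (P := F.P K) (K - J)) k z) : ℝ) = c.jac (V, z)) ∧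
    IsOpen ((Subtype.val : {z : GaugeField (F.P K) 0 (Matrix.specialUnitaryGroup (Fin 2) ℂ) | c.jac (V, z) ≠ 0} → GaugeField (F.P K) 0 (Matrix.specialUnitaryGroup (Fin 2) ℂ)) ⁻¹' {z | c.Φ (V, z) ∈ (histGood F ℰp (θBal F.L γ b₀ p₀) K J)}) ∧
    (∀ k, ∀ z ∈ {z : GaugeField (F.P K) 0 (Matrix.specialUnitaryGroup (Fin 2) ℂ) | c.jac (V, z) ≠ 0}, c.Φ (V, z) ∈ (histGood F ℰp (θBal F.L γ b₀ p₀) K J) → c.Φ (V, Summit.QuantumFields.YangMills.Theorems.FluctuationComparisonRegPrIntLS2BetaResidualSubgroup.pivotAct F hJK (Summit.QuantumFields.YangMills.Theorems.FluctuationComparisonRegPrIntLWregChain.iterCentralBond (P := F.P K) (K - J)) k z) ∈ (histGood F ℰp (θBal F.L γ b₀ p₀) K J)) ∧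
    (∀ z ∈ {z : GaugeField (F.P K) 0 (Matrix.specialUnitaryGroup (Fin 2) ℂ) | c.jac (V, z) ≠ 0}, ∀ b, (∀ c', Summit.QuantumFields.YangMills.Theorems.FluctuationComparisonRegPrIntLWregChain.iterCentralBond (P := F.P K) (K - J) c' ≠ b) → c.Φ (V, z) b = z b) ∧
    (∀ z ∈ {z : GaugeField (F.P K) 0 (Matrix.specialUnitaryGroup (Fin 2) ℂ) | c.jac (V, z) ≠ 0}, descendTo F ℰp J K hJK (c.Φ (V, z)) = V) ∧
    (∀ U, descendTo F ℰp J K hJK U = V → U ∈ (histGood F ℰp (θBal F.L γ b₀ p₀) K J) → (c.jac (V, U) ≠ 0 ∧ c.Φ (V, U) = U) ∧ {z : GaugeField (F.P K) 0 (Matrix.specialUnitaryGroup (Fin 2) ℂ) | c.jac (V, z) ≠ 0} ∈ 𝓝 U)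

/-- **THE PER-DATUM (C3β″) + (T2) + (C2) PACKAGE** (text = the binder types of ✓`…S2BetaLaplaceInstLocal.laplaceLimit_of_charts_local` (w5-20520 g13∕g14)
that are neither chart rows nor EXW∕GAP♯ consequences — the group chart `e` of `residualSubgroup × SU(2)^{pivots}` at `1`, a transversal `σ` through the
minimising history `U₀`, LOCALLY in the carrier (w5 g14 WORD 2), a window `W`, a density `Jd`, a radius `ρ`, with the tubular Haar chart identity for
`pivotAct ∘ (e, σ)` and the slice rows for the common sheet set `Sst` (px21 g9∕g10's ✓`…S2BetaTubularChartDockTransversal.exists_tubularHaarChart_pivotAct_transversal`,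
RG-K's stabiliser rows) — PLUS the OFF-PIVOT QUADRATIC TRANSVERSALITY row (T2) of that theorem VERBATIM (GAP♯-free; the growth of the action along `σ` is then
GAP♯ ∘ ✓`…S2BetaFibreGrowth.growth_of_offPivot_orbitDist_le` (px11 g10), derived in `cornerLimit_of_rows`), and the (C2) row «the action through the chart and the
transversal is `C²` at `0`» (w5-20520 g14's (C2-d) `contDiffAt_wilsonAction4_windowChart_of_histGood`), which ✓`…S2BetaLaplacePeano.hessianRows_of_contDiffAt_of_growth`
turns (with the growth) into the door's Hessian rows. [cite: Helgason2000, Ch. I §1 Thm 1.14 p.96; Balaban1985Variational, Thm 1 (8)-(10) p.279 and (142) p.299; Breitung1994, Thm 41 p.56] -/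
def ChartPackage (c : Summit.QuantumFields.YangMills.Theorems.FluctuationComparisonRegPrIntLWregGlue.WindowChart F hJK (histGood F ℰp (θBal F.L γ b₀ p₀) K J) {V : GaugeField (F.P J) 0 (Matrix.specialUnitaryGroup (Fin 2) ℂ) | PlaqSmall (θBal F.L γ b₀ p₀ J) V}) (dZ dV : ℕ) (Sst : Set (↥(Summit.QuantumFields.YangMills.Theorems.FluctuationComparisonRegPrIntLS2BetaResidualSubgroup.residualSubgroup F hJK) × (PBond (F.P K) (K - J) → (Matrix.specialUnitaryGroup (Fin 2) ℂ)))) (V : GaugeField (F.P J) 0 (Matrix.specialUnitaryGroup (Fin 2) ℂ)) (U₀ : GaugeField (F.P K) 0 (Matrix.specialUnitaryGroup (Fin 2) ℂ)) : Prop :=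
  ∃ (e : EuclideanSpace ℝ (Fin dZ) → (↥(Summit.QuantumFields.YangMills.Theorems.FluctuationComparisonRegPrIntLS2BetaResidualSubgroup.residualSubgroup F hJK) × (PBond (F.P K) (K - J) → (Matrix.specialUnitaryGroup (Fin 2) ℂ)))) (σ : EuclideanSpace ℝ (Fin dV) → GaugeField (F.P K) 0 (Matrix.specialUnitaryGroup (Fin 2) ℂ)) (W : Set (EuclideanSpace ℝ (Fin dZ) × EuclideanSpace ℝ (Fin dV))) (Jd : EuclideanSpace ℝ (Fin dZ) × EuclideanSpace ℝ (Fin dV) → ℝ) (ρ : ℝ),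
    Continuous e ∧ e 0 = 1 ∧ 𝓝 (1 : (↥(Summit.QuantumFields.YangMills.Theorems.FluctuationComparisonRegPrIntLS2BetaResidualSubgroup.residualSubgroup F hJK) × (PBond (F.P K) (K - J) → (Matrix.specialUnitaryGroup (Fin 2) ℂ)))) ≤ map e (𝓝 0) ∧
    Continuous σ ∧ σ 0 = U₀ ∧ (∀ᶠ y in 𝓝 (0 : EuclideanSpace ℝ (Fin dV)), σ y ∈ {z : GaugeField (F.P K) 0 (Matrix.specialUnitaryGroup (Fin 2) ℂ) | c.jac (V, z) ≠ 0}) ∧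
    (∃ c₁ : ℝ, 0 < c₁ ∧ ∀ᶠ y in 𝓝 (0 : EuclideanSpace ℝ (Fin dV)),
      c₁ * ‖y‖ ^ 2 ≤ ⨅ w : {w : Site (F.P K) 0 → (Matrix.specialUnitaryGroup (Fin 2) ℂ) |
            ∀ U : GaugeField (F.P K) 0 (Matrix.specialUnitaryGroup (Fin 2) ℂ), descendTo F ℰp J K hJK (GaugeField.gaugeAct w U) = descendTo F ℰp J K hJK U},
          ∑ ℓ ∈ Finset.univ.filter (fun ℓ : PBond (F.P K) 0 => ∀ c', Summit.QuantumFields.YangMills.Theorems.FluctuationComparisonRegPrIntLWregChain.iterCentralBond (P := F.P K) (K - J) c' ≠ ℓ),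
            dist1 (σ y ℓ * ((GaugeField.gaugeAct (w : Site (F.P K) 0 → (Matrix.specialUnitaryGroup (Fin 2) ℂ)) U₀) ℓ)⁻¹) ^ 2) ∧
    𝓝 (σ 0) ≤ map (fun p : EuclideanSpace ℝ (Fin dZ) × EuclideanSpace ℝ (Fin dV) => Summit.QuantumFields.YangMills.Theorems.FluctuationComparisonRegPrIntLS2BetaResidualSubgroup.pivotAct F hJK (Summit.QuantumFields.YangMills.Theorems.FluctuationComparisonRegPrIntLWregChain.iterCentralBond (P := F.P K) (K - J)) (e p.1) (σ p.2)) (𝓝 0) ∧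
    IsOpen W ∧ InjOn (fun p : EuclideanSpace ℝ (Fin dZ) × EuclideanSpace ℝ (Fin dV) => Summit.QuantumFields.YangMills.Theorems.FluctuationComparisonRegPrIntLS2BetaResidualSubgroup.pivotAct F hJK (Summit.QuantumFields.YangMills.Theorems.FluctuationComparisonRegPrIntLWregChain.iterCentralBond (P := F.P K) (K - J)) (e p.1) (σ p.2)) W ∧
    ContinuousOn Jd W ∧ (∀ w ∈ W, 0 ≤ Jd w) ∧
    (fieldMeasure (F.P K) 0 (Matrix.specialUnitaryGroup (Fin 2) ℂ)).restrict ((fun p : EuclideanSpace ℝ (Fin dZ) × EuclideanSpace ℝ (Fin dV) => Summit.QuantumFields.YangMills.Theorems.FluctuationComparisonRegPrIntLS2BetaResidualSubgroup.pivotAct F hJK (Summit.QuantumFields.YangMills.Theorems.FluctuationComparisonRegPrIntLWregChain.iterCentralBond (P := F.P K) (K - J)) (e p.1) (σ p.2)) '' W) =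
      ((((volume : Measure (EuclideanSpace ℝ (Fin dZ))).prod (volume : Measure (EuclideanSpace ℝ (Fin dV)))).restrict W).withDensity fun w => ENNReal.ofReal (Jd w)).map
        (fun p : EuclideanSpace ℝ (Fin dZ) × EuclideanSpace ℝ (Fin dV) => Summit.QuantumFields.YangMills.Theorems.FluctuationComparisonRegPrIntLS2BetaResidualSubgroup.pivotAct F hJK (Summit.QuantumFields.YangMills.Theorems.FluctuationComparisonRegPrIntLWregChain.iterCentralBond (P := F.P K) (K - J)) (e p.1) (σ p.2)) ∧
    0 < ρ ∧ Metric.closedBall (0 : EuclideanSpace ℝ (Fin dZ)) ρ ×ˢ {(0 : EuclideanSpace ℝ (Fin dV))} ⊆ W ∧ 0 < ∫ z in Metric.ball (0 : EuclideanSpace ℝ (Fin dZ)) ρ, Jd (z, 0) ∧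
    (∀ k, Summit.QuantumFields.YangMills.Theorems.FluctuationComparisonRegPrIntLS2BetaResidualSubgroup.pivotAct F hJK (Summit.QuantumFields.YangMills.Theorems.FluctuationComparisonRegPrIntLWregChain.iterCentralBond (P := F.P K) (K - J)) k (σ 0) = σ 0 → k ∈ Sst) ∧ (∀ s ∈ Sst, ∀ y, Summit.QuantumFields.YangMills.Theorems.FluctuationComparisonRegPrIntLS2BetaResidualSubgroup.pivotAct F hJK (Summit.QuantumFields.YangMills.Theorems.FluctuationComparisonRegPrIntLWregChain.iterCentralBond (P := F.P K) (K - J)) s (σ y) = σ y) ∧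
    ContDiffAt ℝ 2 (fun y => wilsonAction4 (c.Φ (V, σ y))) 0

/-- **CHART-SMOOTH** (v8 docking stub): for every block size, profile and coupling (GAP♯'s prefix) and every `J ≤ K`: COMMON dimensions `dZ dV` (the
exponent of (T) is `dV∕2` at every corner) and sheet set `Sst`, ONE window chart `c` on `histGood` over the `θ_J`-window with `ChartRows`, and for every window
datum `V` and every minimising small-field history `U₀ ∈ argminHist V` the `ChartPackage`.  Suppliers: CHART∞ (w3-20520 g14 V-c3∕V-e1: `ChartRows` by
`…ChartContLaplaceRows.exists_laplaceRows`), (C3β″)+(T2) (px21 g9∕g10: `e σ W Jd ρ` and the transversality row, by `exists_tubularHaarChart_pivotAct_transversal`),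
RG-K (px11 g9: `Sst`, stabiliser rows), (C2) (w5-20520 g14 (C2-a,c,d) ∕ px11 g10 (C2-b): the `C²` row).  Why it might fail: the action through the window chart
of record is only continuous, not `C²`, along the transversal at some minimiser (CHART∞ (a)∕(C2)). The stub ∃-quantifies ITS chart: the `C²` row is a property
of that chart. [cite: Balaban1985Averaging, §E Prop 6 p.26-27; Balaban1985Variational, Thm 1 (8)-(10) p.279; Helgason2000, Ch. I §1 Thm 1.14 p.96] -/
def ChartSmooth : Prop :=
  ∀ (L : ℕ), ∃ pS : ℝ, ∀ (b₀ p₀ : ℝ), 0 < b₀ → pS ≤ p₀ → 0 < p₀ → ∃ ε₁ : ℝ, 0 < ε₁ ∧ ∀ (ε₀ : ℝ), 0 < ε₀ → ε₀ ≤ ε₁ →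
    ∃ γ₁ : ℝ, 0 < γ₁ ∧ ∀ (F : T3Family) (γ : ℝ), F.L = L → 0 < γ → γ ≤ γ₁ →
      ∀ (J K : ℕ) (hJK : J ≤ K),
        ∃ (dZ dV : ℕ) (Sst : Set (↥(Summit.QuantumFields.YangMills.Theorems.FluctuationComparisonRegPrIntLS2BetaResidualSubgroup.residualSubgroup F hJK) × (PBond (F.P K) (K - J) → (Matrix.specialUnitaryGroup (Fin 2) ℂ)))) (c : Summit.QuantumFields.YangMills.Theorems.FluctuationComparisonRegPrIntLWregGlue.WindowChart F hJK (histGood F ℰp (θBal F.L γ b₀ p₀) K J) {V : GaugeField (F.P J) 0 (Matrix.specialUnitaryGroup (Fin 2) ℂ) | PlaqSmall (θBal F.L γ b₀ p₀ J) V}),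
          ChartRows F γ b₀ p₀ hJK c ∧
          ∀ (V : GaugeField (F.P J) 0 (Matrix.specialUnitaryGroup (Fin 2) ℂ)), PlaqSmall (θBal F.L γ b₀ p₀ J) V → ∀ U₀ ∈ argminHist F γ b₀ p₀ ε₀ hJK V,
            ChartPackage F γ b₀ p₀ hJK c dZ dV Sst V U₀

end LaplaceDocking

open scoped Matrix.Norms.L2Operator in
/-- **CHART-SMOOTH — PROVED (v9; was the v8 docking stub)** by projection from the landed suppliers: CHART∞ V-c3∕V-e1 (w3-20520 g14
`exists_laplaceRows`), (C3β″)+(T2) (px21 g9∕g10 `exists_tubularHaarChart_pivotAct_transversal`), RG-K (px11 g9 stabiliser rows; `Sst :=` central sheets × `{1}`),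
(C2) (w5-20520 g14 `contDiffAt_wilsonAction4_windowChart_of_histGood` + `exists_gamma_chainRegime`, over px11 g10's (C2-b)) — all GAP♯-free; thresholds `pS := 0`, `ε₁ := 1`,
`γ₁ := min γ_{V-c3} γ_{chain regime}`.
[cite: Balaban1985Averaging, §E Prop 6 p.26-27; Balaban1985Variational, Thm 1 (8)-(10) p.279; Helgason2000, Ch. I §1 Thm 1.14 p.96] -/
theorem chartSmooth_docked : ChartSmooth := by
  classical
  intro L
  refine ⟨0, fun b₀ p₀ hb _ hp0 => ⟨1, one_pos, fun ε₀ _ _ => ?_⟩⟩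
  obtain ⟨γA, hγA, HA⟩ := Summit.QuantumFields.YangMills.Theorems.FluctuationComparisonRegPrIntLS2BetaChartContLaplaceRows.exists_laplaceRows L b₀ p₀ hb hp0
  obtain ⟨α, γB, hα, hα24, hαδ, hγB, HB⟩ := Summit.QuantumFields.YangMills.Theorems.FluctuationComparisonRegPrIntLS2BetaPeanoSmooth.exists_gamma_chainRegime L b₀ p₀ hb hp0
  refine ⟨min γA γB, lt_min hγA hγB, fun F γ hFL hγ hγle J K hJK => ?_⟩
  obtain ⟨c, T, w, h1, h2, h3, h4, h5, h6, h7, h8, h9, h10, h11, h12, hrows⟩ := HA F γ hFL hγ (hγle.trans (min_le_left _ _)) J K hJK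
  obtain ⟨hαL, hθ0, hθα⟩ := HB F γ hFL hγ (hγle.trans (min_le_right _ _)) K
  have hk : K - J ≤ (F.P K).m + (F.P K).K := by
    show K - J ≤ F.m + K
    omega
  have hι := Summit.QuantumFields.YangMills.Theorems.FluctuationComparisonRegPrIntLWregChain.iterCentralBond_injective (P := F.P K) hk
  have hcomb : ∀ b ∈ (Summit.QuantumFields.YangMills.Theorems.FluctuationComparisonRegPrIntLS2BetaSignedCombKill.combSet (P := F.P K) (K - J) : Set (PBond (F.P K) 0)), ¬ ∃ c', Summit.QuantumFields.YangMills.Theorems.FluctuationComparisonRegPrIntLWregChain.iterCentralBond (P := F.P K) (K - J) c' = b :=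
    fun b hb ⟨c', hc'⟩ => Summit.QuantumFields.YangMills.Theorems.FluctuationComparisonRegPrIntLS2BetaSignedCombCount.iterCentralBond_not_mem_combSet hk c' (hc' ▸ hb)
  refine ⟨Module.finrank ℝ (specialUnitaryLogChart (Fin 2)).lie *
      ((Fintype.card (Site (F.P K) 0) - Fintype.card (Site (F.P K) (K - J))) + Fintype.card (PBond (F.P K) (K - J))),
    Module.finrank ℝ (specialUnitaryLogChart (Fin 2)).lie * (Fintype.card (PBond (F.P K) 0) - Fintype.card (PBond (F.P K) (K - J))) -
      Module.finrank ℝ (specialUnitaryLogChart (Fin 2)).lie * (Fintype.card (Site (F.P K) 0) - Fintype.card (Site (F.P K) (K - J))),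
    {k | k.2 = 1 ∧ ∃ c₀ : Matrix.specialUnitaryGroup (Fin 2) ℂ, (∀ g : Matrix.specialUnitaryGroup (Fin 2) ℂ, c₀ * g = g * c₀) ∧
      (k.1 : Site (F.P K) 0 → Matrix.specialUnitaryGroup (Fin 2) ℂ) = fun _ => c₀}, c, fun V => ?_, fun V hV U₀ hU₀ => ?_⟩
  · -- the CHART rows: CHART∞ V-c3's export, per datum
    obtain ⟨hXc, hXinv, hvan, hA, ha, hAinv, hainv, hOrel, hOinv⟩ := hrows V
    refine ⟨hXc, hXinv, hvan, hA, ha, (h3 V).1, hAinv, hainv, hOrel, hOinv, fun z hz b hb => (h8 V z ((h2 V z).1 hz).1).1 b hb,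
      fun z hz => h1 V z hz, fun U hUV hUg => ⟨h7 V U hUV (subset_closure hUg), h11 V U hUV hUg⟩⟩
  · -- the per-datum package: px21's (C3β″)+(T2) dock ⊕ V-e1 ⊕ RG-K ⊕ (C2-d)
    obtain ⟨hU₀V, hU₀g, -⟩ := hU₀
    obtain ⟨e, σ, W, Jd, ρ, hec, he1, he𝓝, hσc, hσ0, hσs, -, -, hT2, hΘ, hWo, hinj, hJc, hJ0, hchart, hρ, hρW, hJ00⟩ :=
      Summit.QuantumFields.YangMills.Theorems.FluctuationComparisonRegPrIntLS2BetaTubularChartDockTransversal.exists_tubularHaarChart_pivotAct_transversal F hJK hk _ _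
        rfl rfl U₀
    have hnhds : {z : GaugeField (F.P K) 0 (Matrix.specialUnitaryGroup (Fin 2) ℂ) | c.jac (V, z) ≠ 0} ∈ 𝓝 U₀ := h11 V U₀ hU₀V hU₀g
    have hself : c.jac (V, U₀) ≠ 0 ∧ c.Φ (V, U₀) = U₀ := h7 V U₀ hU₀V (subset_closure hU₀g)
    have hσt : Tendsto σ (𝓝 0) (𝓝 U₀) := hσ0 ▸ hσc.tendsto 0
    refine ⟨e, σ, W, Jd, ρ, hec, he1, he𝓝, hσc, hσ0, hσt.eventually hnhds, hT2, hΘ, hWo, hinj, hJc, hJ0, hchart, hρ, hρW, hJ00,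
      fun k hk' => Summit.QuantumFields.YangMills.Theorems.FluctuationComparisonRegPrIntLS2BetaResidualGaugeStabiliser.pivotAct_eq_self_imp_central F hJK _ hι hcomb k (σ 0) hk', ?_, ?_⟩
    · rintro s ⟨hs2, c₀, hc₀, hs1⟩ y
      have hs : s = (⟨fun _ => c₀, Summit.QuantumFields.YangMills.Theorems.FluctuationComparisonRegPrIntLS2BetaResidualSubgroup.const_mem_residualSubgroup_of_comm F hJK hc₀⟩, 1) := Prod.ext (Subtype.ext hs1) hs2
      rw [hs]
      exact Summit.QuantumFields.YangMills.Theorems.FluctuationComparisonRegPrIntLS2BetaResidualGaugeStabiliser.pivotAct_central_sheet_eq F hJK _ hc₀ (σ y)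
    · exact Summit.QuantumFields.YangMills.Theorems.FluctuationComparisonRegPrIntLS2BetaPeanoSmooth.contDiffAt_wilsonAction4_windowChart_of_histGood F hJK hk hα24 hαδ hαL hθ0 hθα c V U₀
        (fun z hz => h1 V z hz) (fun z hz b hb => (h8 V z ((h2 V z).1 hz).1).1 b hb) (h3 V).1 hself.1 hself.2 hnhds hU₀V hU₀g σ hσc hσ0 hσs 2

/-- **THE PER-CORNER SCALED LAPLACE LIMIT (PROVED, v8)**: at a window datum `x`, from EXW (a minimising small-field history `U₀` exists: clause 2), GAP♯ at
`(x, U₀)` (orbit-distance growth, through px11 g10's seam (e) `…S2BetaFibreTransport.limitInst_exw_gap_rows_of_chartRows`; quadratic growth along the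
transversal = GAP♯ ∘ ✓`…S2BetaFibreGrowth.growth_of_offPivot_orbitDist_le` ∘ the package's (T2) row, on the event `c.Φ (x,·) ∈ histGood`, which holds along `σ`
near `0` by the relative openness row), the chart rows and the chart package at `(x, U₀)` ((C2) row + growth → Hessian rows by
✓`…S2BetaLaplacePeano.hessianRows_of_contDiffAt_of_growth`), the LIMIT door
✓`…S2BetaLaplaceInstLocal.laplaceLimit_of_charts_local` (w5-20520 g13∕g14) yields `∃ ℓ > 0, λ^{dV∕2}·(heightDensityCan(γ∕λ) x · e^{λ β_K m(x)}) → ℓ`.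
[cite: Balaban1985Variational, Thm 1 (8)-(10) p.279; Breitung1994, Thm 41 p.56] -/
theorem cornerLimit_of_rows (F : T3Family) {γ : ℝ} (hγ : 0 < γ) (b₀ p₀ ε₀ : ℝ) {J K : ℕ} (hJK : J ≤ K) {μ : ℝ} (hμ : 0 < μ)
    (hE : ∀ (V : GaugeField (F.P J) 0 (Matrix.specialUnitaryGroup (Fin 2) ℂ)), PlaqSmall (θBal F.L γ b₀ p₀ J) V →
        (∀ U ∈ fibre F ℰp J K hJK V, U ∈ histGood F ℰp (θBal F.L γ b₀ p₀) K J →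
            minActionRegPr F J K hJK ε₀ V ≤ wilsonAction4 U) ∧
        (∃ U₀ ∈ regFibrePr F J K hJK ε₀ V, U₀ ∈ histGood F ℰp (θBal F.L γ b₀ p₀) K J ∧
            wilsonAction4 U₀ = minActionRegPr F J K hJK ε₀ V))
    (hG : ∀ (V : GaugeField (F.P J) 0 (Matrix.specialUnitaryGroup (Fin 2) ℂ)), PlaqSmall (θBal F.L γ b₀ p₀ J) V →
        ∀ U₀ ∈ argminHist F γ b₀ p₀ ε₀ hJK V, ∀ U ∈ fibre F ℰp J K hJK V, U ∈ histGood F ℰp (θBal F.L γ b₀ p₀) K J →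
          μ * ((F.L : ℝ)⁻¹) ^ (2 * (K - J)) *
              (⨅ w : ResidualGauge F hJK, ∑ ℓ : PBond (F.P K) 0,
                dist1 (U ℓ * ((GaugeField.gaugeAct (w : GaugeTransf (F.P K) 0 (Matrix.specialUnitaryGroup (Fin 2) ℂ)) U₀) ℓ)⁻¹) ^ 2)
            ≤ wilsonAction4 U - minActionRegPr F J K hJK ε₀ V)
    {dZ dV : ℕ} {Sst : Set (↥(Summit.QuantumFields.YangMills.Theorems.FluctuationComparisonRegPrIntLS2BetaResidualSubgroup.residualSubgroup F hJK) × (PBond (F.P K) (K - J) → (Matrix.specialUnitaryGroup (Fin 2) ℂ)))}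
    {c : Summit.QuantumFields.YangMills.Theorems.FluctuationComparisonRegPrIntLWregGlue.WindowChart F hJK (histGood F ℰp (θBal F.L γ b₀ p₀) K J)
      {V : GaugeField (F.P J) 0 (Matrix.specialUnitaryGroup (Fin 2) ℂ) | PlaqSmall (θBal F.L γ b₀ p₀ J) V}}
    (hCR : ChartRows F γ b₀ p₀ hJK c)
    (hPK : ∀ (V : GaugeField (F.P J) 0 (Matrix.specialUnitaryGroup (Fin 2) ℂ)), PlaqSmall (θBal F.L γ b₀ p₀ J) V →
      ∀ U₀ ∈ argminHist F γ b₀ p₀ ε₀ hJK V, ChartPackage F γ b₀ p₀ hJK c dZ dV Sst V U₀)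
    (x : GaugeField (F.P J) 0 (Matrix.specialUnitaryGroup (Fin 2) ℂ)) (hx : PlaqSmall (θBal F.L γ b₀ p₀ J) x) :
    ∃ ℓ : ℝ, 0 < ℓ ∧
      Tendsto (fun lam : ℝ => lam ^ ((dV : ℝ) / 2) *
        (heightDensityCan F (γ / lam) hJK (histGood F ℰp (θBal F.L γ b₀ p₀) K J) x *
          Real.exp (lam * (F.scheme ℰp γ).β K * minActionRegPr F J K hJK ε₀ x))) atTop (𝓝 ℓ) := by
  classical
  obtain ⟨-, U₀, hU₀reg, hU₀good, hU₀min⟩ := hE x hx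
  have hU₀fib : U₀ ∈ fibre F ℰp J K hJK x := ((mem_regFibrePr_iff F).1 hU₀reg).1
  have hU₀arg : U₀ ∈ argminHist F γ b₀ p₀ ε₀ hJK x := ⟨hU₀fib, hU₀good, hU₀min⟩
  obtain ⟨e, σ, Wn, Jd, ρ, he, he1, he𝓝, hσ, hσ0, hσX, ⟨c₂, hc₂, hT2⟩, hΘ'𝓝, hWo, hinj, hJc, hJ0, hchart, hρ, hρW, hJ00, hstab, hfix, hC2⟩ :=
    hPK x hx U₀ hU₀arg
  obtain ⟨hXc, hXinv, hvan, hA, ha, hΦc, hAinv, hainv, hOrel, hOinv, hoff, hfib, hrec⟩ := hCR x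
  obtain ⟨hself, -⟩ := hrec U₀ hU₀fib hU₀good
  have hLpos : (0 : ℝ) < F.L := Nat.cast_pos.2 (by have := F.hL.2; omega)
  have hμ' : 0 < μ * ((F.L : ℝ)⁻¹) ^ (2 * (K - J)) := mul_pos hμ (pow_pos (inv_pos.2 hLpos) _)
  have hgap := fun U hU hUS => hG x hx U₀ hU₀arg U hU hUS
  obtain ⟨hO0, hmin, ha0, hg, hg0, hgpos, hgrow⟩ :=
    Summit.QuantumFields.YangMills.Theorems.FluctuationComparisonRegPrIntLS2BetaFibreTransport.limitInst_exw_gap_rows_of_chartRows F hJK c.Φ c.jac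
      hμ' hU₀good hU₀min hself hgap hoff hfib hΦc
  -- the event `c.Φ (x, ·) ∈ histGood` is relatively open in the carrier (hOrel), so it holds along the transversal near `0`
  obtain ⟨O', hO'open, hO'eq⟩ := isOpen_induced_iff.1 hOrel
  have hO'iff : ∀ z (hz : z ∈ {z : GaugeField (F.P K) 0 (Matrix.specialUnitaryGroup (Fin 2) ℂ) | c.jac (x, z) ≠ 0}), z ∈ O' ↔ c.Φ (x, z) ∈ (histGood F ℰp (θBal F.L γ b₀ p₀) K J) := fun z hz => by
    have h := congrArg (fun s : Set {z : GaugeField (F.P K) 0 (Matrix.specialUnitaryGroup (Fin 2) ℂ) | c.jac (x, z) ≠ 0} => (⟨z, hz⟩ : {z : GaugeField (F.P K) 0 (Matrix.specialUnitaryGroup (Fin 2) ℂ) | c.jac (x, z) ≠ 0}) ∈ s) hO'eq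
    exact Iff.of_eq h
  have hU₀O' : U₀ ∈ O' := (hO'iff U₀ hself.1).2 (by rw [hself.2]; exact hU₀good)
  have hσO' : ∀ᶠ y in 𝓝 (0 : EuclideanSpace ℝ (Fin dV)), σ y ∈ O' :=
    (hσ.tendsto' 0 U₀ hσ0).eventually (hO'open.mem_nhds hU₀O')
  -- growth along the transversal: GAP♯ ∘ (H2-red) ∘ (T2)
  have hgrowth : ∀ᶠ y in 𝓝 (0 : EuclideanSpace ℝ (Fin dV)),
      (μ * ((F.L : ℝ)⁻¹) ^ (2 * (K - J)) * c₂) * ‖y‖ ^ 2 ≤ wilsonAction4 (c.Φ (x, σ y)) - wilsonAction4 (c.Φ (x, σ 0)) := by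
    filter_upwards [hσX, hT2, hσO'] with y hyX hyT hyO
    have hyG : c.Φ (x, σ y) ∈ (histGood F ℰp (θBal F.L γ b₀ p₀) K J) := (hO'iff (σ y) hyX).1 hyO
    have h := Summit.QuantumFields.YangMills.Theorems.FluctuationComparisonRegPrIntLS2BetaFibreGrowth.growth_of_offPivot_orbitDist_le F hJK c.Φ hμ'
      hgap hoff hfib hyX hyG (t := c₂ * ‖y‖ ^ 2) hyT
    have h0 : wilsonAction4 (c.Φ (x, σ 0)) = minActionRegPr F J K hJK ε₀ x := by rw [hσ0, hself.2]; exact hU₀min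
    rw [h0]
    nlinarith [h, hc₂, hμ', norm_nonneg y]
  obtain ⟨Ah, hAs, hpos, hS2⟩ :=
    Summit.QuantumFields.YangMills.Theorems.FluctuationComparisonRegPrIntLS2BetaLaplacePeano.hessianRows_of_contDiffAt_of_growth hC2 (mul_pos hμ' hc₂) hgrowth
  haveI := Summit.QuantumFields.YangMills.Theorems.FluctuationComparisonRegPrIntLS2BetaResidualSubgroup.compactSpace_residualSubgroup F hJK
  have hk : K - J ≤ (F.P K).m + (F.P K).K := by
    show K - J ≤ F.m + K
    omega
  subst hσ0
  exact Summit.QuantumFields.YangMills.Theorems.FluctuationComparisonRegPrIntLS2BetaLaplaceInstLocal.laplaceLimit_of_charts_local F hγ hJK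
    (measurableSet_histGood F ℰp measurableE_ℰp _ K J)
    (Summit.QuantumFields.YangMills.Theorems.FluctuationComparisonRegPrIntLWregAssembly.isOpen_setOf_plaqSmall₂ (F.P J) 0 _) c hx
    (minActionRegPr F J K hJK ε₀ x) (Summit.QuantumFields.YangMills.Theorems.FluctuationComparisonRegPrIntLS2BetaResidualSubgroup.residualSubgroup F hJK) (Summit.QuantumFields.YangMills.Theorems.FluctuationComparisonRegPrIntLS2BetaResidualSubgroup.compactSpace_residualSubgroup F hJK) MeasureTheory.Measure.haar
    (Summit.QuantumFields.YangMills.Theorems.FluctuationComparisonRegPrIntLS2BetaResidualSubgroup.pivotAct F hJK (Summit.QuantumFields.YangMills.Theorems.FluctuationComparisonRegPrIntLWregChain.iterCentralBond (P := F.P K) (K - J)))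
    (Summit.QuantumFields.YangMills.Theorems.FluctuationComparisonRegPrIntLS2BetaResidualSubgroup.continuous_pivotAct F hJK _)
    (Summit.QuantumFields.YangMills.Theorems.FluctuationComparisonRegPrIntLS2BetaResidualSubgroup.pivotAct_mul F hJK _ (Summit.QuantumFields.YangMills.Theorems.FluctuationComparisonRegPrIntLWregChain.iterCentralBond_injective (P := F.P K) hk))
    (Summit.QuantumFields.YangMills.Theorems.FluctuationComparisonRegPrIntLS2BetaResidualSubgroup.pivotAct_one F hJK _)
    (Summit.QuantumFields.YangMills.Theorems.FluctuationComparisonRegPrIntLS2BetaResidualSubgroup.measurePreserving_pivotAct F hJK _)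
    hXc hXinv hvan hA ha hAinv hainv hOrel hOinv e σ he he1 he𝓝 hσ hσX hΘ'𝓝 hWo hinj hJc hJ0 hchart hρ hρW hJ00 hstab hfix hO0 hmin ha0
    hg hg0 hgpos hgrow hAs hpos hS2



/-! ## §1 Polymer-representation ALGEBRA (new, PROVED): monotonicity in the norm, additivity, finite sums

A ledger of per-scale remainders is summed into ONE representation: disjoint union of the polymer systems (`Fin.append`), weights and lengths
appended, constants added; the pinned exponentially-weighted sums add (`Fin.sum_univ_add`).  [cite: Balaban1987RG1, (0.23)-(0.26)] -/

section PolymerAlgebra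

variable {P : Params} {G : Type*}

/-- **MONOTONICITY**: a representation of norm `≤ N` is one of norm `≤ N'` for `N ≤ N'`. [cite: Balaban1987RG1, (0.25)-(0.26)] -/
theorem polymerRepOn_mono {W : Set (GaugeField P 0 G)} {κ N N' : ℝ} {f : GaugeField P 0 G → ℝ} (h : PolymerRepOn W κ N f) (hN : N ≤ N') :
    PolymerRepOn W κ N' f := by
  obtain ⟨n, supp, len, wt, act, c, hloc, hwt, hdiam, hbd, hcov, hrep⟩ := h
  exact ⟨n, supp, len, wt, act, c, hloc, hwt, hdiam, hbd, fun e => (hcov e).trans hN, hrep⟩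

/-- **CONGRUENCE ON THE WINDOW**: a representation only reads its function on `W`. [cite: Balaban1987RG1, (0.23)-(0.26)] -/
theorem polymerRepOn_congr {W : Set (GaugeField P 0 G)} {κ N : ℝ} {f g : GaugeField P 0 G → ℝ} (h : PolymerRepOn W κ N f)
    (hfg : ∀ U, U ∈ W → g U = f U) : PolymerRepOn W κ N g := by
  obtain ⟨n, supp, len, wt, act, c, hloc, hwt, hdiam, hbd, hcov, hrep⟩ := h
  exact ⟨n, supp, len, wt, act, c, hloc, hwt, hdiam, hbd, hcov, fun U hU => (hfg U hU).trans (hrep U hU)⟩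

open Classical in
/-- **ADDITIVITY (PROVED)**: representations of `f` (norm `≤ N₁`) and `g` (norm `≤ N₂`) on the same window at the same rate concatenate to one of `f + g` of
norm `≤ N₁ + N₂` — print's «Σ_j Σ_{X∈D_j} E^{(j)}(X)» read as ONE localized expansion. [cite: Balaban1987RG1, (0.23)-(0.26)] -/
theorem polymerRepOn_add {W : Set (GaugeField P 0 G)} {κ N₁ N₂ : ℝ} {f g : GaugeField P 0 G → ℝ} (hf : PolymerRepOn W κ N₁ f)
    (hg : PolymerRepOn W κ N₂ g) : PolymerRepOn W κ (N₁ + N₂) (fun U => f U + g U) := by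
  obtain ⟨n₁, supp₁, len₁, wt₁, act₁, c₁, hloc₁, hwt₁, hdiam₁, hbd₁, hcov₁, hrep₁⟩ := hf
  obtain ⟨n₂, supp₂, len₂, wt₂, act₂, c₂, hloc₂, hwt₂, hdiam₂, hbd₂, hcov₂, hrep₂⟩ := hg
  refine ⟨n₁ + n₂, Fin.append supp₁ supp₂, Fin.append len₁ len₂, Fin.append wt₁ wt₂, Fin.append act₁ act₂, c₁ + c₂,
    ?_, ?_, ?_, ?_, ?_, ?_⟩
  · intro X U U' hUU'
    cases X using Fin.addCases with
    | left i => rw [Fin.append_left] at hUU' ⊢; exact hloc₁ i U U' hUU'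
    | right i => rw [Fin.append_right] at hUU' ⊢; exact hloc₂ i U U' hUU'
  · intro X
    cases X using Fin.addCases with
    | left i => rw [Fin.append_left]; exact hwt₁ i
    | right i => rw [Fin.append_right]; exact hwt₂ i
  · intro X
    cases X using Fin.addCases with
    | left i => rw [Fin.append_left, Fin.append_left]; exact hdiam₁ i
    | right i => rw [Fin.append_right, Fin.append_right]; exact hdiam₂ i
  · intro X U hU
    cases X using Fin.addCases with
    | left i => rw [Fin.append_left, Fin.append_left]; exact hbd₁ i U hU
    | right i => rw [Fin.append_right, Fin.append_right]; exact hbd₂ i U hU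
  · intro e
    rw [Finset.sum_filter, Fin.sum_univ_add]
    simp only [Fin.append_left, Fin.append_right]
    rw [← Finset.sum_filter, ← Finset.sum_filter]
    exact add_le_add (hcov₁ e) (hcov₂ e)
  · intro U hU
    rw [Fin.sum_univ_add]
    simp only [Fin.append_left, Fin.append_right]
    rw [hrep₁ U hU, hrep₂ U hU]; ring

open Classical in
/-- **FINITE SUMS (PROVED)**: a finite ledger of representations `R i` of norms `≤ a i` sums to one of `Σ_i R i` of norm `≤ Σ_i a i`.
[cite: Balaban1987RG1, (0.23)-(0.26)] -/
theorem polymerRepOn_finset_sum {ι : Type*} (s : Finset ι) {W : Set (GaugeField P 0 G)} {κ : ℝ} {a : ι → ℝ}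
    {R : ι → GaugeField P 0 G → ℝ} (h : ∀ i ∈ s, PolymerRepOn W κ (a i) (R i)) :
    PolymerRepOn W κ (∑ i ∈ s, a i) (fun U => ∑ i ∈ s, R i U) := by
  induction s using Finset.induction_on with
  | empty =>
    simpa using polymerRepOn_of_const W κ 0 (fun _ => (0 : ℝ)) (fun _ _ => rfl)
  | insert i s hi ih =>
    have h₁ := h i (Finset.mem_insert_self i s)
    have h₂ := ih (fun j hj => h j (Finset.mem_insert_of_mem hj))
    rw [Finset.sum_insert hi]
    exact polymerRepOn_congr (polymerRepOn_add h₁ h₂) (fun U _ => Finset.sum_insert hi)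

/-- `fourPt` is additive and kills constants (used to read the ledger identity at the 4-point level). [cite: Balaban1985UV3, (41) p.266] -/
theorem fourPt_const_add_add {X : Type*} (c : ℝ) (f g : X → ℝ) (U V W Z : X) :
    fourPt (fun x => c + f x + g x) U V W Z = fourPt f U V W Z + fourPt g U V W Z := by
  unfold fourPt; ring


/-! ### §1b TRANSPORT OF REPRESENTATIONS UNDER A LOCAL INTER-LATTICE MAP (RELOC, PROVED; v5 — count-neutral tool).  A representation on FINE-lattice fields,
composed with a map `m : coarse fields → fine fields` that is LOCAL (the fine bond `b` of `m U` depends on `U` only through the coarse bonds `dep b`), with affine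
distance distortion `tdist(dep b, dep b′) ≤ A·tdist(b,b′) + B` and multiplicity `#{b | e ∈ dep b} ≤ D`, is a representation on coarse fields at any rate `κ′` with
`κ′A ≤ κ`, of norm `≤ D·e^{κ′B}·N`.  This is the bookkeeping half of every per-step proof of REP (transport of the entries born at a finer level to the datum level
through the minimiser/interpolation map): it quantifies the relocalisation constant `C_reloc = D·e^{κ′B}` (for one averaging step `D ~ L³`) that the FLATNESS EXTRACTION
of a Bałaban step must beat (the `θ^i` of the print format comes from the coupling AND that extraction, not from this lemma).
[cite: Balaban1987RG1, (0.23)-(0.26) pp.256-257; Balaban1985UV3, (41)-(47) pp.266-267] -/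

/-- Folklore: a finite sum of non-negative terms over a `biUnion` is at most the sum of the sums (restated; cf. the tree's
`Literature.Analysis.Complex.HeightAveraging.sum_biUnion_le_sum_sum`). [folklore] -/
theorem sum_biUnion_le_sum_sum' {ι α : Type*} [DecidableEq α] (s : Finset ι) (t : ι → Finset α)
    (f : α → ℝ) (hf : ∀ a, 0 ≤ f a) :
    ∑ a ∈ s.biUnion t, f a ≤ ∑ i ∈ s, ∑ a ∈ t i, f a := by
  classical
  induction s using Finset.induction_on with
  | empty => simp
  | insert i s hi ih =>
    rw [Finset.biUnion_insert, Finset.sum_insert hi]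
    have h := Finset.sum_union_inter (s₁ := t i) (s₂ := s.biUnion t) (f := f)
    have h0 : 0 ≤ ∑ a ∈ t i ∩ s.biUnion t, f a := Finset.sum_nonneg fun a _ ↦ hf a
    linarith

open Classical in
/-- **RELOC · TRANSPORT OF A V-LOCAL POLYMER REPRESENTATION UNDER A LOCAL INTER-LATTICE MAP (PROVED).**  `P` = the fine lattice (where `f` is represented on the
window `W`), `P'` = the coarse lattice, `m : GaugeField P' → GaugeField P` maps the coarse window `W'` into `W` and is local with dependency sets `dep`; distances
distort affinely (`A`, `B`), multiplicities are `≤ D`.  Then `f ∘ m` is represented on `W'` at every rate `κ'` with `κ'·A ≤ κ`, with norm `D·e^{κ'B}·N`: supports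
`⋃_{b ∈ supp X} dep b`, lengths `A·len X + B`, same weights and constants. [cite: Balaban1987RG1, (0.23)-(0.26) pp.256-257] -/
theorem polymerRepOn_transport {P' : Params} {W : Set (GaugeField P 0 G)} {κ N : ℝ} {f : GaugeField P 0 G → ℝ}
    (h : PolymerRepOn W κ N f) (m : GaugeField P' 0 G → GaugeField P 0 G) {W' : Set (GaugeField P' 0 G)} (hW : Set.MapsTo m W' W)
    (dep : PBond P 0 → Finset (PBond P' 0))
    (hdep : ∀ (b : PBond P 0) (U U' : GaugeField P' 0 G), (∀ e ∈ dep b, U e = U' e) → m U b = m U' b)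
    {A B : ℝ} (hA : 0 ≤ A)
    (hdist : ∀ (b b' : PBond P 0), ∀ e ∈ dep b, ∀ e' ∈ dep b', (e.src.tdist e'.src : ℝ) ≤ A * (b.src.tdist b'.src : ℝ) + B)
    {D : ℕ} (hD : ∀ e : PBond P' 0, (Finset.univ.filter (fun b : PBond P 0 => e ∈ dep b)).card ≤ D)
    {κ' : ℝ} (hκ : κ' * A ≤ κ) (hN : 0 ≤ N) :
    PolymerRepOn W' κ' (D * Real.exp (κ' * B) * N) (f ∘ m) := by
  obtain ⟨n, supp, len, wt, act, c, hloc, hwt, hlen, hact, hnorm, hid⟩ := h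
  refine ⟨n, fun X => (supp X).biUnion dep, fun X => A * len X + B, wt, fun X U => act X (m U), c, ?_, hwt, ?_, ?_, ?_, ?_⟩
  · -- V-locality on the coarse lattice
    intro X U U' hUU'
    refine hloc X (m U) (m U') fun b hb => hdep b U U' fun e he => hUU' e ?_
    exact Finset.mem_biUnion.2 ⟨b, hb, he⟩
  · -- lengths dominate the transported supports' diameters
    intro X e he e' he'
    obtain ⟨b, hb, heb⟩ := Finset.mem_biUnion.1 he
    obtain ⟨b', hb', heb'⟩ := Finset.mem_biUnion.1 he'
    have h1 := hdist b b' e heb e' heb'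
    have h2 := hlen X b hb b' hb'
    nlinarith [mul_le_mul_of_nonneg_left h2 hA]
  · -- weights on the coarse window
    intro X U hU
    exact hact X (m U) (hW hU)
  · -- the weighted norm
    intro e
    have key : Finset.univ.filter (fun X => e ∈ (supp X).biUnion dep)
        ⊆ (Finset.univ.filter (fun b : PBond P 0 => e ∈ dep b)).biUnion (fun b => Finset.univ.filter (fun X => b ∈ supp X)) := by
      intro X hX
      simp only [Finset.mem_filter, Finset.mem_univ, true_and, Finset.mem_biUnion] at hX ⊢
      obtain ⟨b, hb, he⟩ := hX
      exact ⟨b, he, hb⟩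
    have hterm : ∀ X, 0 ≤ wt X * Real.exp (κ' * (A * len X + B)) := fun X => mul_nonneg (hwt X) (Real.exp_nonneg _)
    have perb : ∀ b : PBond P 0, ∑ X ∈ Finset.univ.filter (fun X => b ∈ supp X), wt X * Real.exp (κ' * (A * len X + B))
        ≤ Real.exp (κ' * B) * N := by
      intro b
      have hle : ∀ X ∈ Finset.univ.filter (fun X => b ∈ supp X),
          wt X * Real.exp (κ' * (A * len X + B)) ≤ Real.exp (κ' * B) * (wt X * Real.exp (κ * len X)) := by
        intro X hX
        simp only [Finset.mem_filter, Finset.mem_univ, true_and] at hX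
        have hlen0 : 0 ≤ len X := (Nat.cast_nonneg _).trans (hlen X b hX b hX)
        have hexp : Real.exp (κ' * (A * len X + B)) ≤ Real.exp (κ' * B) * Real.exp (κ * len X) := by
          rw [← Real.exp_add]
          exact Real.exp_le_exp.2 (by nlinarith [mul_le_mul_of_nonneg_right hκ hlen0])
        calc wt X * Real.exp (κ' * (A * len X + B)) ≤ wt X * (Real.exp (κ' * B) * Real.exp (κ * len X)) :=
              mul_le_mul_of_nonneg_left hexp (hwt X)
          _ = Real.exp (κ' * B) * (wt X * Real.exp (κ * len X)) := by ring
      calc ∑ X ∈ Finset.univ.filter (fun X => b ∈ supp X), wt X * Real.exp (κ' * (A * len X + B))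
          ≤ ∑ X ∈ Finset.univ.filter (fun X => b ∈ supp X), Real.exp (κ' * B) * (wt X * Real.exp (κ * len X)) := Finset.sum_le_sum hle
        _ = Real.exp (κ' * B) * ∑ X ∈ Finset.univ.filter (fun X => b ∈ supp X), wt X * Real.exp (κ * len X) := by rw [Finset.mul_sum]
        _ ≤ Real.exp (κ' * B) * N := mul_le_mul_of_nonneg_left (hnorm b) (Real.exp_nonneg _)
    calc ∑ X ∈ Finset.univ.filter (fun X => e ∈ (supp X).biUnion dep), wt X * Real.exp (κ' * (A * len X + B))
        ≤ ∑ X ∈ (Finset.univ.filter (fun b : PBond P 0 => e ∈ dep b)).biUnion (fun b => Finset.univ.filter (fun X => b ∈ supp X)),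
            wt X * Real.exp (κ' * (A * len X + B)) := Finset.sum_le_sum_of_subset_of_nonneg key (fun X _ _ => hterm X)
      _ ≤ ∑ b ∈ Finset.univ.filter (fun b : PBond P 0 => e ∈ dep b), ∑ X ∈ Finset.univ.filter (fun X => b ∈ supp X),
            wt X * Real.exp (κ' * (A * len X + B)) := sum_biUnion_le_sum_sum' _ _ _ hterm
      _ ≤ ∑ b ∈ Finset.univ.filter (fun b : PBond P 0 => e ∈ dep b), Real.exp (κ' * B) * N := Finset.sum_le_sum fun b _ => perb b
      _ = ((Finset.univ.filter (fun b : PBond P 0 => e ∈ dep b)).card : ℝ) * (Real.exp (κ' * B) * N) := by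
            rw [Finset.sum_const, nsmul_eq_mul]
      _ ≤ (D : ℝ) * (Real.exp (κ' * B) * N) :=
            mul_le_mul_of_nonneg_right (by exact_mod_cast hD e) (mul_nonneg (Real.exp_nonneg _) hN)
      _ = D * Real.exp (κ' * B) * N := by ring
  · -- the identity on the coarse window
    intro U hU
    exact hid (m U) (hW hU)

end PolymerAlgebra

/-! ## §1c (v6) THE GAS FORMAT (verbatim from LINE g19-1 `Lines/largefield_gas.lean` §1: `IsLocalActivity`, `gasZ`, `KPGasOn`, `KPLogRep` — token-identical, so
pen ym-ust-20520-w3 g15's Theorems-side `…S2BetaKPLogRep.kpLogRep` / `kpLogRep'` closes `KPLogRep` HERE by δ-unfolding exactly as in LINE g19-1 v3): the RAW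
output format of a cluster expansion — a hard-core gas of bond polymers with V-local field-dependent real activities and a field-uniform Kotecký–Preiss majorant —
and the abstract lemma KPL turning `log Ξ(w_U)` into a `PolymerRepOn`.  Used in §3d to offer the organ hand print's (0.26)/(1.97) door. -/

section Gas

variable {P : Params} {G : Type*}

/-- **V-LOCAL ACTIVITIES**: the activity of the bond polymer `X` depends on the field only through the bonds of `X` ([Balaban1989LargeFieldII] p.390
«𝐑′^{(k)}(X) depends on the background field U_k restricted to X»). [cite: Balaban1989LargeFieldII, (1.99) p.390] -/
def IsLocalActivity (w : GaugeField P 0 G → Finset (PBond P 0) → ℝ) : Prop :=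
  ∀ (X : Finset (PBond P 0)) (U U' : GaugeField P 0 G), (∀ e ∈ X, U e = U' e) → w U X = w U' X

open Classical in
/-- **THE HARD-CORE GAS PARTITION FUNCTION OF THE FIELD-DEPENDENT ACTIVITIES** `Ξ(w_U) = Σ_{compatible families} Π w_U(X)` over ALL bond polymers of the
lattice, incompatible iff equal or overlapping (`polyInc`) — the curly bracket `{⋯} = 1 + Σ_r Σ_{{X′₁,…,X′_r}} Π_p F(X′_p)` of (1.90) (real part: the
activities are real). [cite: Balaban1989LargeFieldII, (1.90) p.388] -/
def gasZ (w : GaugeField P 0 G → Finset (PBond P 0) → ℝ) (U : GaugeField P 0 G) : ℝ :=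
  (Literature.Probability.LatticeModels.polymerPartitionFunction Literature.Probability.LatticeModels.polyInc
    (fun X : Finset (PBond P 0) => ((w U X : ℝ) : ℂ)) Finset.univ).re

open Classical in
/-- **A KOTECKÝ–PREISS GAS ON THE WINDOW `W` AT RATE `κ` WITH ONE-BOND SIZE `≤ N`**: real V-local activities vanishing on the empty polymer, a
field-INDEPENDENT majorant `w̄ ≥ |w_U|` on `W`, lengths `ℓ X ≥` the source-distance diameter of `X`, a size function `a ≥ 0` with the Kotecký–Preiss
inequality `Σ_{X′ ι X} w̄ X′ · e^{a X′ + κ ℓ X′} ≤ a X` ([KP86] (1) with `d = κℓ`) and `a {e} ≤ N` for every bond `e` (the pinned size; print's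
`exp(−p₀(g_k))` of (1.100)). [cite: Balaban1989LargeFieldII, (1.97) p.389 and (1.100) p.390; KoteckyPreiss1986, Theorem p.492 (1)] -/
def KPGasOn (W : Set (GaugeField P 0 G)) (κ N : ℝ) (w : GaugeField P 0 G → Finset (PBond P 0) → ℝ) : Prop :=
  ∃ (wbar a ℓ : Finset (PBond P 0) → ℝ),
    (∀ U, w U ∅ = 0) ∧ IsLocalActivity w ∧ (∀ X, 0 ≤ a X) ∧ (∀ X, 0 ≤ ℓ X) ∧
    (∀ U, U ∈ W → ∀ X, |w U X| ≤ wbar X) ∧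
    (∀ X : Finset (PBond P 0), ∀ e ∈ X, ∀ e' ∈ X, (e.src.tdist e'.src : ℝ) ≤ ℓ X) ∧
    (∀ X : Finset (PBond P 0), ∑ X' ∈ Finset.univ.filter (fun X' => Literature.Probability.LatticeModels.polyInc X' X),
        wbar X' * Real.exp (a X' + κ * ℓ X') ≤ a X) ∧
    (∀ e : PBond P 0, a {e} ≤ N)

end Gas

/-- **KPL · THE CLUSTER-EXPANSION LEMMA (abstract, gauge-free)** — LINE g19-1's `KPLogRep`, token-identical: a Kotecký–Preiss gas on `W` at rate `κ ≥ 0` with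
one-bond size `≤ N` represents `U ↦ log Ξ(w_U)` as a V-local polymer representation on `W` of weighted norm `≤ N` at rate `κ`.  NOT a stub of this line: it is
CLOSED on the Theorems side by pen ym-ust-20520-w3 g15 (KPL-A `…S2BetaKPLIncrement` ✓, KPL-B `…S2BetaKPLExpansion`, KPL-C `…S2BetaKPLSignMajorant` — the
alternating-sign majorant [ScottSokal2005] Prop. 2.8 —, KPL-D `…S2BetaKPLogRep.kpLogRep`/`kpLogRep'`); §3d consumes it as a hypothesis AND by name (`kpLogRep_closed`, right below).
[cite: Balaban1989LargeFieldII, (1.98)-(1.99) p.390; KoteckyPreiss1986, Theorem p.492 (2),(4); ScottSokal2005, Prop. 2.8] -/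
def KPLogRep : Prop :=
  ∀ (P : Params) (W : Set (GaugeField P 0 (Matrix.specialUnitaryGroup (Fin 2) ℂ))) (κ N : ℝ), 0 ≤ κ →
    ∀ w : GaugeField P 0 (Matrix.specialUnitaryGroup (Fin 2) ℂ) → Finset (PBond P 0) → ℝ,
      KPGasOn W κ N w → PolymerRepOn W κ N (fun U => Real.log (gasZ w U))

/-- **KPL CLOSED BY NAME (v6)** on pen ym-ust-20520-w3 g15's ✓p744986 `…S2BetaKPLogRep.kpLogRep` (KPL-A ✓p744391, KPL-B ✓p744575, KPL-C ✓p744796 beneath it):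
δ-unfolding only — the texts of §0b/§1c are token-identical to LINE g19-1's. [cite: KoteckyPreiss1986, Theorem p.492 (2),(4); ScottSokal2005, Prop. 2.8] -/
theorem kpLogRep_closed : KPLogRep :=
  Summit.QuantumFields.YangMills.Theorems.FluctuationComparisonRegPrIntLS2BetaKPLogRep.kpLogRep

/-! ## §2 The DEFINED one-loop part, the hand-ready stub SCL, and the ORGAN of this line: the LOOP LEDGER at the physical coupling (stub LEDGER, XL) -/

section Organ

variable (F : T3Family) (γ b₀ p₀ ε₀ : ℝ) {J K : ℕ} (hJK : J ≤ K)

/-- **THE ONE-LOOP PART `F₀` AS A DEFINED OBJECT** (new): the pointwise semiclassical limit of the λ-scaled fluctuation part NORMALISED AT THE FLAT FIELD,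
`F₀(V) := lim_{λ→∞} (f^λ(V) − f^λ(1))` (junk where the limit fails; SCL says it does not on the window).  In print this is the Gaussian-approximation term of
the effective action — `½ log` of the ratio of fluctuation-operator determinants over the fibres of `V` and of `1` ([Balaban1985Variational] Thm 1 (8)–(10)
p.279: the background field and the expansion around it; [Balaban1987RG1] (0.17)–(0.22)).  Being DEFINED (a `limUnder`), it is shared by the two stubs
below BY NAME — no `∃ F₀` is passed between them. [cite: Balaban1985Variational, Thm 1 (8)-(10) p.279] -/
def oneLoopPartCan (V : GaugeField (F.P J) 0 (Matrix.specialUnitaryGroup (Fin 2) ℂ)) : ℝ :=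
  limUnder atTop (fun lam : ℝ => fluctAtCan F γ b₀ p₀ ε₀ hJK lam V - fluctAtCan F γ b₀ p₀ ε₀ hJK lam 1)

/-- If the normalised λ-family converges at `V`, it converges to `oneLoopPartCan V`. [cite: Balaban1985Variational, Thm 1 (8) p.279] -/
theorem tendsto_oneLoopPartCan {V : GaugeField (F.P J) 0 (Matrix.specialUnitaryGroup (Fin 2) ℂ)}
    (h : ∃ a : ℝ, Tendsto (fun lam : ℝ => fluctAtCan F γ b₀ p₀ ε₀ hJK lam V - fluctAtCan F γ b₀ p₀ ε₀ hJK lam 1) atTop (𝓝 a)) :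
    Tendsto (fun lam : ℝ => fluctAtCan F γ b₀ p₀ ε₀ hJK lam V - fluctAtCan F γ b₀ p₀ ε₀ hJK lam 1) atTop
      (𝓝 (oneLoopPartCan F γ b₀ p₀ ε₀ hJK V)) :=
  tendsto_nhds_limUnder h

/-- **SCL · THE POINTWISE SEMICLASSICAL LIMIT EXISTS ON THE WINDOW (stub; M; hand-ready)**: in the regime of the package, for every run `K`, height `J ≤ K`
and window point `V`, `f^λ(V) − f^λ(1)` converges as `λ → ∞` (coupling `γ/λ → 0` at FIXED lattices and FIXED history windows `θBal(γ)`).  This is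
Laplace's method for the RATIO of two fibre integrals `∫_{fibre(V) ∩ hist} e^{−β_K(γ/λ) A} / ∫_{fibre(1) ∩ hist} e^{−β_K(γ/λ) A}` with the classical factors
`e^{−β·A_min}` removed by the `β_K · minActionRegPr` term of `f^λ`: minima along a residual-gauge ORBIT of the same dimension in both fibres (gauge
transformations trivial at block centres preserve every fibre), nondegenerate transversally (the averaging constraint removes zero modes), interior to
the sharp history windows for window `V` ([Balaban1985Variational] Thm 1 p.279: existence, uniqueness mod gauge and regularity of the constrained
minimiser; the tree's orbit-Laplace asymptotics `LaplaceMethodOrbitOpenAmplitude`-type theorems of the LAPLACE hands are the tool).  POINTWISE in `V`,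
NO uniformity in `J, K, F` is asked.  Why it might fail: at a window point where the canonical version vanishes for large `λ` the `Real.log` is junk
(1L4ᶜ (R)/(P) say it does not); a degenerate transversal Hessian over `fibre(1)` (a lattice zero mode surviving the averaging constraint) would make the
two Laplace prefactor powers of `λ` differ and the difference diverge like `c·log λ`. [cite: Balaban1985Variational, Thm 1 (8)-(10) p.279; Balaban1987RG1, (0.17)-(0.22)] -/
def SemiclassicalLimitCan : Prop :=
  ∀ (L : ℕ), ∃ pS : ℝ, ∀ (b₀ p₀ : ℝ), 0 < b₀ → pS ≤ p₀ → 0 < p₀ → ∃ ε₁ : ℝ, 0 < ε₁ ∧ ∀ (ε₀ : ℝ), 0 < ε₀ → ε₀ ≤ ε₁ →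
    ∃ γ₁ : ℝ, 0 < γ₁ ∧ ∀ (F : T3Family) (γ : ℝ), F.L = L → 0 < γ → γ ≤ γ₁ →
      ∀ (J K : ℕ) (hJK : J ≤ K) (V : GaugeField (F.P J) 0 (Matrix.specialUnitaryGroup (Fin 2) ℂ)), PlaqSmall (θBal F.L γ b₀ p₀ J) V →
        ∃ a : ℝ, Tendsto (fun lam : ℝ => fluctAtCan F γ b₀ p₀ ε₀ hJK lam V - fluctAtCan F γ b₀ p₀ ε₀ hJK lam 1) atTop (𝓝 a)

/-- **LEDGER · THE LOOP LEDGER OF THE SMALL-FIELD EFFECTIVE ACTION AT THE PHYSICAL COUPLING (organ stub; XL)**.  Same prefix as H4ᶜ with one more structural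
constant chosen with `κ`: a PER-STEP CONTRACTION FACTOR `θ ∈ (0,1)`.  Content: for every run `K` and height `J ≤ K`, ON THE WINDOW the λ = 1 fluctuation part
minus its DEFINED one-loop part is the POINTWISE identity `f^1 − F₀ = c + Σ_{i < K−J} R_i` — one remainder per renormalization step `J+1+i` integrated out —
where the step-`i` remainder has a V-local polymer representation on the window at rate `κ` of norm `≤ Φ J · θ^i`, `J·Φ J → 0`, uniform in the depth.
Print: the effective action after `k` steps IS such a ledger, `A_k = −(1/g_k²)A(U_k) + Σ_{j=1}^{k} [−β_j A(U_k) + E^{(j)}(U_k)]`, `E^{(j)}(U) = Σ_{X∈D_j}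
E^{(j)}(X,U)` analytic, gauge invariant, depending on `U` restricted to `X`, `|E^{(j)}(X,U)| ≤ E₀ e^{−κ d_j(X)}` ([Balaban1987RG1] (0.22)–(0.26)
pp.256–257, d = 4); at d = 3 there are no `β_j` counterterms and «each renormalization transformation … decreases by the factor L^{−2n} ≤ L^{−4}»
([Balaban1985UV3] (41)–(46) pp.266–267: the per-step sum `Σ_j Σ_{Y_j} 𝒫_j(y) g_j² ξ_{L^{−j}}(U_{k,j}, A_j)`, «the condition n ≥ 2 plays a crucial role») —
whence `θ`; the entries are the terms BEYOND the Gaussian approximation of the `j`-th fluctuation integral (loop-counting parameter `g_j² = γ L^{−j}`,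
superrenormalisable) and the sharp-constraint tails of that step — whence `J·Φ J → 0`.  Why it might fail: (i) print states per-step BOUNDS for d = 3 YM;
the IDENTITY with V-local activities at the datum and a clean one-loop / beyond split per step is printed only for d = 4 ((0.23)) and for scalar models
([Dimock2011] arXiv:1108.1335 Thm 1); (ii) the window-tail part of `R_i` is tiny but its polymer LOCALITY at the datum is large-field machinery in disguise;
(iii) `F₀` is the flat-normalised LIMIT, so the identity also asserts the exact cancellation of the classical term `β·A(U_min)` against `β_K·minActionRegPr`
at every depth (the package's standing bet, cf. 1L4ᶜ (R)/(P)). [cite: Balaban1987RG1, (0.22)-(0.26) pp.256-257; Balaban1985UV3, (41)-(46) pp.266-267; Balaban1988Convergent, Thm 1] -/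
def LoopLedgerCan : Prop :=
  ∀ (L : ℕ), ∃ pS : ℝ, ∀ (b₀ p₀ : ℝ), 0 < b₀ → pS ≤ p₀ → 0 < p₀ → ∃ ε₁ : ℝ, 0 < ε₁ ∧ ∀ (ε₀ : ℝ), 0 < ε₀ → ε₀ ≤ ε₁ →
    ∃ γ₁ : ℝ, 0 < γ₁ ∧ ∃ κ : ℝ, 0 < κ ∧ ∃ θ : ℝ, 0 < θ ∧ θ < 1 ∧
      ∀ (F : T3Family) (γ : ℝ), F.L = L → 0 < γ → γ ≤ γ₁ →
        ∃ Φ : ℕ → ℝ, (∀ J, 0 ≤ Φ J) ∧ Tendsto (fun J : ℕ => (J : ℝ) * Φ J) atTop (𝓝 0) ∧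
          ∀ (J K : ℕ) (hJK : J ≤ K),
            ∃ (c : ℝ) (R : ℕ → GaugeField (F.P J) 0 (Matrix.specialUnitaryGroup (Fin 2) ℂ) → ℝ) (a : ℕ → ℝ),
              (∀ U : GaugeField (F.P J) 0 (Matrix.specialUnitaryGroup (Fin 2) ℂ), PlaqSmall (θBal F.L γ b₀ p₀ J) U →
                  fluctAtCan F γ b₀ p₀ ε₀ hJK 1 U = c + oneLoopPartCan F γ b₀ p₀ ε₀ hJK U + ∑ i ∈ Finset.range (K - J), R i U) ∧
              (∀ i ∈ Finset.range (K - J), PolymerRepOn {U | PlaqSmall (θBal F.L γ b₀ p₀ J) U} κ (a i) (R i)) ∧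
              (∀ i ∈ Finset.range (K - J), a i ≤ Φ J * θ ^ i)


/-- **REP = LEDGER₀ · THE ORGAN STUB OF THIS LINE SINCE v4 (critic idea-crit-5 g9 #368 P1, option (a))**: the beyond-one-loop part of the physical-coupling
fluctuation part has ONE small V-local polymer representation on the window, depth-uniformly — same prefix as H4ᶜ, then `∃ Φ ≥ 0, J·Φ J → 0, ∀ J ≤ K, ∃ c R a,
f¹ = c + F₀ + R` ON THE WINDOW, `R ∈ PolymerRepOn(window, κ, a)`, `a ≤ Φ J`.  HONESTY NOTE (why the stub is REP and not LEDGER): as Lean text the per-step ledger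
`LoopLedgerCan` is EQUIVALENT to this one-step collapse up to `Φ ↦ Φ/(1−θ)` — (⇒) PROVED below (`beyondOneLoopRep_of_loopLedgerCan`: sum the entries,
`polymerRepOn_finset_sum` + `ledger_budget_le`), (⇐) put `R₀ := R`, `R_i := 0` (norm-0 representations exist) except at depth 0 where LEDGER additionally says `R = 0`
— so the `θ^i` dressing demanded nothing a prover must deliver beyond REP (no scale-indexed locality is even expressible at the datum level: entries born at the
FINER levels `J+1+i` are ultralocal at level `J`).  LEDGER stays in the file as the documented PRINT FORMAT ([Balaban1987RG1] (0.22)–(0.26): `A_k = … + Σ_j E^{(j)}`,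
the `E^{(j)}` being the SAME functions composed with the background maps) in which a Bałaban-style proof delivers REP, with its collapse PROVED; the WALL is
conserved and counted ONCE: REP is where the XL small-field hand goes (the d = 3 effective action in IDENTITY form with V-local activities and the one-loop/beyond
split at the datum; print has per-step BOUNDS (41)–(46) of [Balaban1985UV3], identity form only at d = 4 and for scalar models), and its standing bet — exact
cancellation of the classical term against `β_K·minActionRegPr` at every depth — is the package's one bet shared with 1L4ᶜ (R)/(P), not a new one.
[cite: Balaban1985UV3, (41)-(47) pp.266-267; Balaban1987RG1, (0.22)-(0.26) pp.256-257; Balaban1988Convergent, Thm 1] -/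
def BeyondOneLoopRepCan : Prop :=
  ∀ (L : ℕ), ∃ pS : ℝ, ∀ (b₀ p₀ : ℝ), 0 < b₀ → pS ≤ p₀ → 0 < p₀ → ∃ ε₁ : ℝ, 0 < ε₁ ∧ ∀ (ε₀ : ℝ), 0 < ε₀ → ε₀ ≤ ε₁ →
    ∃ γ₁ : ℝ, 0 < γ₁ ∧ ∃ κ : ℝ, 0 < κ ∧
      ∀ (F : T3Family) (γ : ℝ), F.L = L → 0 < γ → γ ≤ γ₁ →
        ∃ Φ : ℕ → ℝ, (∀ J, 0 ≤ Φ J) ∧ Tendsto (fun J : ℕ => (J : ℝ) * Φ J) atTop (𝓝 0) ∧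
          ∀ (J K : ℕ) (hJK : J ≤ K),
            ∃ (c : ℝ) (R : GaugeField (F.P J) 0 (Matrix.specialUnitaryGroup (Fin 2) ℂ) → ℝ) (a : ℝ),
              (∀ U : GaugeField (F.P J) 0 (Matrix.specialUnitaryGroup (Fin 2) ℂ), PlaqSmall (θBal F.L γ b₀ p₀ J) U →
                  fluctAtCan F γ b₀ p₀ ε₀ hJK 1 U = c + oneLoopPartCan F γ b₀ p₀ ε₀ hJK U + R U) ∧
              PolymerRepOn {U | PlaqSmall (θBal F.L γ b₀ p₀ J) U} κ a R ∧ a ≤ Φ J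

end Organ

/-! ## §3 The PROVED reduction: SCL ∧ LEDGER ⇒ H4ᶜ (identify Λ₄ = Δ²F₀ from the pointwise limit; sum the ledger; cluster the sum) -/

section Reduction

/-- The geometric bookkeeping: `Σ_{i<n} Φ θ^i ≤ Φ / (1 − θ)`. [cite: Balaban1985UV3, (46)-(47) p.267] -/
theorem ledger_budget_le {θ Φ : ℝ} (hθ0 : 0 ≤ θ) (hθ1 : θ < 1) (hΦ : 0 ≤ Φ) (n : ℕ) :
    ∑ i ∈ Finset.range n, Φ * θ ^ i ≤ Φ / (1 - θ) := by
  have hgeom : ∑ i ∈ Finset.range n, θ ^ i ≤ 1 / (1 - θ) := by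
    have h := geom_sum_Ico_le_of_lt_one (m := 0) (n := n) hθ0 hθ1
    rw [pow_zero] at h
    rw [Finset.range_eq_Ico]; exact h
  rw [← Finset.mul_sum]
  calc Φ * ∑ i ∈ Finset.range n, θ ^ i ≤ Φ * (1 / (1 - θ)) := mul_le_mul_of_nonneg_left hgeom hΦ
    _ = Φ / (1 - θ) := by ring

/-- **SCL ⇒ the canonical one-loop 4-point IS the 4-point of the defined one-loop part** on window quadruples (PROVED): `fourPt f^λ` is a signed sum of the
four flat-normalised differences, each convergent. [cite: Balaban1985Variational, Thm 1 (8) p.279] -/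
theorem oneLoopFourPtCan_eq_fourPt_oneLoopPart (F : T3Family) (γ b₀ p₀ ε₀ : ℝ) {J K : ℕ} (hJK : J ≤ K)
    (U V W Z : GaugeField (F.P J) 0 (Matrix.specialUnitaryGroup (Fin 2) ℂ))
    (hU : ∃ a : ℝ, Tendsto (fun lam : ℝ => fluctAtCan F γ b₀ p₀ ε₀ hJK lam U - fluctAtCan F γ b₀ p₀ ε₀ hJK lam 1) atTop (𝓝 a))
    (hV : ∃ a : ℝ, Tendsto (fun lam : ℝ => fluctAtCan F γ b₀ p₀ ε₀ hJK lam V - fluctAtCan F γ b₀ p₀ ε₀ hJK lam 1) atTop (𝓝 a))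
    (hW : ∃ a : ℝ, Tendsto (fun lam : ℝ => fluctAtCan F γ b₀ p₀ ε₀ hJK lam W - fluctAtCan F γ b₀ p₀ ε₀ hJK lam 1) atTop (𝓝 a))
    (hZ : ∃ a : ℝ, Tendsto (fun lam : ℝ => fluctAtCan F γ b₀ p₀ ε₀ hJK lam Z - fluctAtCan F γ b₀ p₀ ε₀ hJK lam 1) atTop (𝓝 a)) :
    oneLoopFourPtCan F γ b₀ p₀ ε₀ hJK U V W Z = fourPt (oneLoopPartCan F γ b₀ p₀ ε₀ hJK) U V W Z := by
  refine oneLoopFourPtCan_eq_of_tendsto F γ b₀ p₀ ε₀ hJK U V W Z ?_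
  have h := ((tendsto_oneLoopPartCan F γ b₀ p₀ ε₀ hJK hU).sub (tendsto_oneLoopPartCan F γ b₀ p₀ ε₀ hJK hV)).sub
    ((tendsto_oneLoopPartCan F γ b₀ p₀ ε₀ hJK hW).sub (tendsto_oneLoopPartCan F γ b₀ p₀ ε₀ hJK hZ))
  refine (h.congr fun lam => ?_)
  unfold fourPt; ring

/-- **SCL ∧ LEDGER ⇒ H4ᶜ (PROVED).**  SCL identifies `Λ₄ = Δ² F₀` on window quadruples (`oneLoopFourPtCan_eq_fourPt_oneLoopPart`); LEDGER's per-step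
representations sum to ONE representation of `f^1 − F₀ − c` of norm `≤ Σ_i Φ J θ^i ≤ Φ J/(1−θ)` (`polymerRepOn_finset_sum`, `ledger_budget_le`), whose
connected 4-points are κ-clustered (`fourPoint_le_of_polymerRepOn`): H4ᶜ with `φ₂ J := 4 Φ J / (1 − θ)` (thresholds merged by `max`/`min`).
[cite: Balaban1987RG1, (0.23)-(0.26); Balaban1985UV3, (45)-(47) p.267] -/
theorem beyondOneLoopSmallCan_of_ledger (hS : SemiclassicalLimitCan) (hL : LoopLedgerCan) : BeyondOneLoopSmallCan := by
  intro L
  obtain ⟨pS₁, hpS₁⟩ := hS L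
  obtain ⟨pS₂, hpS₂⟩ := hL L
  refine ⟨max pS₁ pS₂, fun b₀ p₀ hb₀ hp hp₀ => ?_⟩
  obtain ⟨ε₁, hε₁, hε⟩ := hpS₁ b₀ p₀ hb₀ ((le_max_left _ _).trans hp) hp₀
  obtain ⟨ε₂, hε₂, hε'⟩ := hpS₂ b₀ p₀ hb₀ ((le_max_right _ _).trans hp) hp₀
  refine ⟨min ε₁ ε₂, lt_min hε₁ hε₂, fun ε₀ hε₀ hε₀₁ => ?_⟩
  obtain ⟨γ₁, hγ₁, hFam₁⟩ := hε ε₀ hε₀ (hε₀₁.trans (min_le_left _ _))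
  obtain ⟨γ₂, hγ₂, κ, hκ, θ, hθ0, hθ1, hFam₂⟩ := hε' ε₀ hε₀ (hε₀₁.trans (min_le_right _ _))
  refine ⟨min γ₁ γ₂, lt_min hγ₁ hγ₂, κ, hκ, fun F γ hFL hγ hγle => ?_⟩
  have hS₁ := hFam₁ F γ hFL hγ (hγle.trans (min_le_left _ _))
  obtain ⟨Φ, hΦ0, hΦlim, hrun⟩ := hFam₂ F γ hFL hγ (hγle.trans (min_le_right _ _))
  have h1θ : 0 < 1 - θ := sub_pos.mpr hθ1
  refine ⟨fun J => 4 * Φ J / (1 - θ), fun J => div_nonneg (mul_nonneg (by norm_num) (hΦ0 J)) h1θ.le, ?_, ?_⟩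
  · have : Tendsto (fun J : ℕ => (4 / (1 - θ)) * ((J : ℝ) * Φ J)) atTop (𝓝 ((4 / (1 - θ)) * 0)) := hΦlim.const_mul _
    rw [mul_zero] at this
    refine this.congr' (Eventually.of_forall fun J => ?_)
    field_simp
  · intro J K hJK b b' U V W Z hU hV hW hZ hUV hUW hVZ hWZ
    obtain ⟨c, R, a, hid, hrep, ha⟩ := hrun J K hJK
    -- Λ₄ = Δ² F₀ from the pointwise semiclassical limits at the four window points
    rw [oneLoopFourPtCan_eq_fourPt_oneLoopPart F γ b₀ p₀ ε₀ hJK U V W Z (hS₁ J K hJK U hU) (hS₁ J K hJK V hV)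
      (hS₁ J K hJK W hW) (hS₁ J K hJK Z hZ)]
    -- the summed ledger and its clustered 4-point
    have hsum : PolymerRepOn {U | PlaqSmall (θBal F.L γ b₀ p₀ J) U} κ (Φ J / (1 - θ))
        (fun U => ∑ i ∈ Finset.range (K - J), R i U) :=
      polymerRepOn_mono (polymerRepOn_finset_sum (Finset.range (K - J)) hrep)
        ((Finset.sum_le_sum ha).trans (ledger_budget_le hθ0.le hθ1 (hΦ0 J) _))
    have h4 := fourPoint_le_of_polymerRepOn hsum hκ.le b b' U V W Z hU hV hW hZ hUV hUW hVZ hWZ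
    have hsplit : fourPt (fluctAtCan F γ b₀ p₀ ε₀ hJK 1) U V W Z
        = fourPt (oneLoopPartCan F γ b₀ p₀ ε₀ hJK) U V W Z + fourPt (fun U => ∑ i ∈ Finset.range (K - J), R i U) U V W Z := by
      rw [← fourPt_const_add_add c]; unfold fourPt; rw [hid U hU, hid V hV, hid W hW, hid Z hZ]
    rw [hsplit, add_sub_cancel_left]
    calc |fourPt (fun U => ∑ i ∈ Finset.range (K - J), R i U) U V W Z|
        ≤ 4 * (Φ J / (1 - θ)) * Real.exp (-(κ * (b.src.tdist b'.src : ℝ))) := by unfold fourPt; exact h4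
      _ = 4 * Φ J / (1 - θ) * Real.exp (-(κ * (b.src.tdist b'.src : ℝ))) := by ring


/-- **LEDGER ⇒ REP (PROVED, v4): the collapse** — sum the entries (`polymerRepOn_finset_sum`), budget `Σ_{i<K−J} Φ J θ^i ≤ Φ J/(1−θ)` (`ledger_budget_le`).
This is the (⇒) half of the honesty note on `BeyondOneLoopRepCan`. [cite: Balaban1985UV3, (46)-(47) p.267] -/
theorem beyondOneLoopRep_of_loopLedgerCan (hL : LoopLedgerCan) : BeyondOneLoopRepCan := by
  intro L
  obtain ⟨pS, H⟩ := hL L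
  refine ⟨pS, fun b₀ p₀ hb hp hp0 => ?_⟩
  obtain ⟨ε₁, hε₁, H1⟩ := H b₀ p₀ hb hp hp0
  refine ⟨ε₁, hε₁, fun ε₀ hε₀ hε₀le => ?_⟩
  obtain ⟨γ₁, hγ₁, κ, hκ, θ, hθ0, hθ1, H2⟩ := H1 ε₀ hε₀ hε₀le
  refine ⟨γ₁, hγ₁, κ, hκ, fun F γ hFL hγ hγle => ?_⟩
  obtain ⟨Φ, hΦ0, hΦ, H3⟩ := H2 F γ hFL hγ hγle
  have h1θ : 0 < 1 - θ := sub_pos.mpr hθ1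
  refine ⟨fun J => Φ J / (1 - θ), fun J => div_nonneg (hΦ0 J) h1θ.le, ?_, fun J K hJK => ?_⟩
  · have : Tendsto (fun J : ℕ => (1 / (1 - θ)) * ((J : ℝ) * Φ J)) atTop (𝓝 ((1 / (1 - θ)) * 0)) := hΦ.const_mul _
    rw [mul_zero] at this
    refine this.congr' (Eventually.of_forall fun J => ?_)
    show (1 / (1 - θ)) * ((J : ℝ) * Φ J) = (J : ℝ) * (Φ J / (1 - θ))
    ring
  · obtain ⟨c, R, a, hid, hrep, ha⟩ := H3 J K hJK
    refine ⟨c, fun U => ∑ i ∈ Finset.range (K - J), R i U, Φ J / (1 - θ), fun U hU => hid U hU, ?_, le_rfl⟩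
    exact polymerRepOn_mono (polymerRepOn_finset_sum (Finset.range (K - J)) hrep)
      ((Finset.sum_le_sum ha).trans (ledger_budget_le hθ0.le hθ1 (hΦ0 J) _))

/-- **SCL ∧ REP ⇒ H4ᶜ (PROVED, v4)** — the reduction for the organ stub of record: SCL identifies `Λ₄ = Δ²F₀` on window quadruples; the ONE representation of
`f¹ − c − F₀` of norm `≤ Φ J` has κ-clustered connected 4-points (`fourPoint_le_of_polymerRepOn`): H4ᶜ with `φ₂ J := 4 Φ J`.
[cite: Balaban1985UV3, (45)-(47) p.267] -/
theorem beyondOneLoopSmallCan_of_rep (hS : SemiclassicalLimitCan) (hR : BeyondOneLoopRepCan) : BeyondOneLoopSmallCan := by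
  intro L
  obtain ⟨pS₁, hpS₁⟩ := hS L
  obtain ⟨pS₂, hpS₂⟩ := hR L
  refine ⟨max pS₁ pS₂, fun b₀ p₀ hb₀ hp hp₀ => ?_⟩
  obtain ⟨ε₁, hε₁, hε⟩ := hpS₁ b₀ p₀ hb₀ ((le_max_left _ _).trans hp) hp₀
  obtain ⟨ε₂, hε₂, hε'⟩ := hpS₂ b₀ p₀ hb₀ ((le_max_right _ _).trans hp) hp₀
  refine ⟨min ε₁ ε₂, lt_min hε₁ hε₂, fun ε₀ hε₀ hε₀₁ => ?_⟩
  obtain ⟨γ₁, hγ₁, hFam₁⟩ := hε ε₀ hε₀ (hε₀₁.trans (min_le_left _ _))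
  obtain ⟨γ₂, hγ₂, κ, hκ, hFam₂⟩ := hε' ε₀ hε₀ (hε₀₁.trans (min_le_right _ _))
  refine ⟨min γ₁ γ₂, lt_min hγ₁ hγ₂, κ, hκ, fun F γ hFL hγ hγle => ?_⟩
  have hS₁ := hFam₁ F γ hFL hγ (hγle.trans (min_le_left _ _))
  obtain ⟨Φ, hΦ0, hΦlim, hrun⟩ := hFam₂ F γ hFL hγ (hγle.trans (min_le_right _ _))
  refine ⟨fun J => 4 * Φ J, fun J => mul_nonneg (by norm_num) (hΦ0 J), ?_, ?_⟩
  · have : Tendsto (fun J : ℕ => 4 * ((J : ℝ) * Φ J)) atTop (𝓝 (4 * 0)) := hΦlim.const_mul _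
    rw [mul_zero] at this
    refine this.congr' (Eventually.of_forall fun J => ?_)
    show 4 * ((J : ℝ) * Φ J) = (J : ℝ) * (4 * Φ J)
    ring
  · intro J K hJK b b' U V W Z hU hV hW hZ hUV hUW hVZ hWZ
    obtain ⟨c, R, a, hid, hrep, ha⟩ := hrun J K hJK
    rw [oneLoopFourPtCan_eq_fourPt_oneLoopPart F γ b₀ p₀ ε₀ hJK U V W Z (hS₁ J K hJK U hU) (hS₁ J K hJK V hV)
      (hS₁ J K hJK W hW) (hS₁ J K hJK Z hZ)]
    have hsum : PolymerRepOn {U | PlaqSmall (θBal F.L γ b₀ p₀ J) U} κ (Φ J) (fun U => R U) := polymerRepOn_mono hrep ha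
    have h4 := fourPoint_le_of_polymerRepOn hsum hκ.le b b' U V W Z hU hV hW hZ hUV hUW hVZ hWZ
    have hsplit : fourPt (fluctAtCan F γ b₀ p₀ ε₀ hJK 1) U V W Z
        = fourPt (oneLoopPartCan F γ b₀ p₀ ε₀ hJK) U V W Z + fourPt (fun U => R U) U V W Z := by
      rw [← fourPt_const_add_add c]; unfold fourPt; rw [hid U hU, hid V hV, hid W hW, hid Z hZ]
    rw [hsplit, add_sub_cancel_left]
    unfold fourPt; exact h4

end Reduction

/-! ## §3b (v2) SCL IS A THEOREM GIVEN EXW AND GAP♯: per-corner scaled Laplace limits with ONE exponent at `V` and at the window datum `1`; the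
`(dV/2)·log λ` terms cancel in the difference `f^λ V − f^λ 1` -/

section SclDocked

/-- **SCL from the docking doors (PROVED, v2)**: CHART-SMOOTH → EXW → GAP♯ → SCL.  Thresholds merged by `max`/`min` (with `γ ≤ 1` for `θBal_pos`); at a window
datum `V`, `cornerLimit_of_rows` at `V` and at `1` (`plaqSmall_one`), then ✓`…S2BetaLaplaceKnit.tendsto_log_add_fluct_of_laplaceLimit` per corner and subtraction.
[cite: Balaban1985Variational, Thm 1 (8)-(10) p.279; Breitung1994, Thm 41 p.56] -/
theorem semiclassicalLimitCan_of_docking (hCS : ChartSmooth) : WindowExactness → UniformFibreGapOrbit → SemiclassicalLimitCan := by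
  intro hE hG L
  obtain ⟨pE, HE⟩ := hE L
  obtain ⟨pG, HG⟩ := hG L
  obtain ⟨pC, HC⟩ := hCS L
  refine ⟨max (max pE pG) pC, fun b₀ p₀ hb hp hp0 => ?_⟩
  obtain ⟨εE, hεE, HE1⟩ := HE b₀ p₀ hb ((le_max_left _ _).trans ((le_max_left _ _).trans hp)) hp0
  obtain ⟨εG, hεG, HG1⟩ := HG b₀ p₀ hb ((le_max_right _ _).trans ((le_max_left _ _).trans hp)) hp0
  obtain ⟨εC, hεC, HC1⟩ := HC b₀ p₀ hb ((le_max_right _ _).trans hp) hp0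
  refine ⟨min (min εE εG) εC, lt_min (lt_min hεE hεG) hεC, fun ε₀ hε₀ hε₀le => ?_⟩
  obtain ⟨γE, hγE, HE2⟩ := HE1 ε₀ hε₀ (hε₀le.trans ((min_le_left _ _).trans (min_le_left _ _)))
  obtain ⟨γG, hγG, μ, hμ, HG2⟩ := HG1 ε₀ hε₀ (hε₀le.trans ((min_le_left _ _).trans (min_le_right _ _)))
  obtain ⟨γC, hγC, HC2⟩ := HC1 ε₀ hε₀ (hε₀le.trans (min_le_right _ _))
  refine ⟨min (min γE γG) (min γC 1), lt_min (lt_min hγE hγG) (lt_min hγC one_pos), fun F γ hFL hγ hγle J K hJK V hV => ?_⟩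
  have hγE' : γ ≤ γE := hγle.trans ((min_le_left _ _).trans (min_le_left _ _))
  have hγG' : γ ≤ γG := hγle.trans ((min_le_left _ _).trans (min_le_right _ _))
  have hγC' : γ ≤ γC := hγle.trans ((min_le_right _ _).trans (min_le_left _ _))
  have hγ1 : γ ≤ 1 := hγle.trans ((min_le_right _ _).trans (min_le_right _ _))
  obtain ⟨dZ, dV, Sst, c, hCR, hPK⟩ := HC2 F γ hFL hγ hγC' J K hJK
  have corner := cornerLimit_of_rows F hγ b₀ p₀ ε₀ hJK hμ (HE2 F γ hFL hγ hγE' J K hJK) (HG2 F γ hFL hγ hγG' J K hJK) hCR hPK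
  have hL1 : 1 ≤ F.L := F.hL.2.le
  have h1 : PlaqSmall (θBal F.L γ b₀ p₀ J) (1 : GaugeField (F.P J) 0 (Matrix.specialUnitaryGroup (Fin 2) ℂ)) :=
    T3DescentFibreTower.plaqSmall_one (T3MinimiserStabilityReduction.θBal_pos hL1 hγ hγ1 hb p₀ J)
  obtain ⟨ℓV, hℓV, tV⟩ := corner V hV
  obtain ⟨ℓ1, hℓ1, t1⟩ := corner 1 h1
  refine ⟨Real.log ℓV - Real.log ℓ1, ?_⟩
  have kV := Summit.QuantumFields.YangMills.Theorems.FluctuationComparisonRegPrIntLS2BetaLaplaceKnit.tendsto_log_add_fluct_of_laplaceLimit F γ hJK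
    (histGood F ℰp (θBal F.L γ b₀ p₀) K J) (minActionRegPr F J K hJK ε₀) tV hℓV
  have k1 := Summit.QuantumFields.YangMills.Theorems.FluctuationComparisonRegPrIntLS2BetaLaplaceKnit.tendsto_log_add_fluct_of_laplaceLimit F γ hJK
    (histGood F ℰp (θBal F.L γ b₀ p₀) K J) (minActionRegPr F J K hJK ε₀) t1 hℓ1
  refine (kV.sub k1).congr' (Eventually.of_forall fun lam => ?_)
  simp only [fluctAtCan, heightDensityCan, Summit.QuantumFields.YangMills.Theorems.FluctuationComparisonRegPrIntLWregGlue.heightDensityCan]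
  ring

/-- **SCL ⇐ EXW ∧ GAP♯ (PROVED, v2)** — with CHART-SMOOTH discharged by `chartSmooth_docked` (LINE g18-1 v9's proof, restated). [cite: Balaban1985Variational, Thm 1 (8)-(10) p.279] -/
theorem semiclassicalLimitCan_of_organs : WindowExactness → UniformFibreGapOrbit → SemiclassicalLimitCan :=
  semiclassicalLimitCan_of_docking chartSmooth_docked

end SclDocked

/-! ## §3c THE FIRST RUNG, TYPED (count-neutral): LEDGER at depth one (`K = J+1` — ONE constrained fluctuation integral over the fibres of one averaging step, sharp
window, unit-gap background) — the hands' entry signature, PROVED to be LEDGER's specialisation -/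

section RungOne

/-- **RUNG 1 · LEDGER AT DEPTH ONE** (the BC5-style first prover target of this line, typed; NOT a stub, adds no sorry).  LEDGER's text with `K := J+1`: the
ledger has exactly one entry, `f¹_{J,J+1} − F₀ − c = R` ON THE WINDOW, `R` V-locally polymer-represented at rate `κ` with norm `≤ Φ J`, `J·Φ J → 0` (no `θ` at
depth one).  Content: the clustered `O(g_J²·window)` bound on the non-Gaussian part of ONE constrained Laplace/fluctuation integral in an ε₀-regular unit-gap background
(EXW + GAP♯ regime) — [Balaban1985UV3] §A (25)-(37) for one step; it lies outside every regime where S2β / 20520 is known (nothing of the tower is known at any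
depth ≥ 1) and exercises exactly this line's lever (per-step polymer norm of the beyond-one-loop part at the physical coupling).
[cite: Balaban1985UV3, (25)-(37) pp.262-265 and (41)-(47) pp.266-267; Balaban1987RG1, (0.22)-(0.26) pp.256-257] -/
def LoopLedgerDepthOneCan : Prop :=
  ∀ (L : ℕ), ∃ pS : ℝ, ∀ (b₀ p₀ : ℝ), 0 < b₀ → pS ≤ p₀ → 0 < p₀ → ∃ ε₁ : ℝ, 0 < ε₁ ∧ ∀ (ε₀ : ℝ), 0 < ε₀ → ε₀ ≤ ε₁ →
    ∃ γ₁ : ℝ, 0 < γ₁ ∧ ∃ κ : ℝ, 0 < κ ∧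
      ∀ (F : T3Family) (γ : ℝ), F.L = L → 0 < γ → γ ≤ γ₁ →
        ∃ Φ : ℕ → ℝ, (∀ J, 0 ≤ Φ J) ∧ Tendsto (fun J : ℕ => (J : ℝ) * Φ J) atTop (𝓝 0) ∧
          ∀ (J : ℕ),
            ∃ (c : ℝ) (R : GaugeField (F.P J) 0 (Matrix.specialUnitaryGroup (Fin 2) ℂ) → ℝ) (a : ℝ),
              (∀ U : GaugeField (F.P J) 0 (Matrix.specialUnitaryGroup (Fin 2) ℂ), PlaqSmall (θBal F.L γ b₀ p₀ J) U →
                  fluctAtCan F γ b₀ p₀ ε₀ (Nat.le_succ J) 1 U = c + oneLoopPartCan F γ b₀ p₀ ε₀ (Nat.le_succ J) U + R U) ∧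
              PolymerRepOn {U | PlaqSmall (θBal F.L γ b₀ p₀ J) U} κ a R ∧ a ≤ Φ J

/-- **LEDGER ⇒ RUNG 1 (PROVED)**: specialise LEDGER to `K := J + 1` (`range (K − J) = {0}`, `θ⁰ = 1`). [cite: Balaban1985UV3, (41)-(47) pp.266-267] -/
theorem loopLedgerDepthOne_of_loopLedgerCan (h : LoopLedgerCan) : LoopLedgerDepthOneCan := by
  intro L
  obtain ⟨pS, H⟩ := h L
  refine ⟨pS, fun b₀ p₀ hb hp hp0 => ?_⟩
  obtain ⟨ε₁, hε₁, H1⟩ := H b₀ p₀ hb hp hp0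
  refine ⟨ε₁, hε₁, fun ε₀ hε₀ hε₀le => ?_⟩
  obtain ⟨γ₁, hγ₁, κ, hκ, θ, hθ, hθ1, H2⟩ := H1 ε₀ hε₀ hε₀le
  refine ⟨γ₁, hγ₁, κ, hκ, fun F γ hFL hγ hγle => ?_⟩
  obtain ⟨Φ, hΦ0, hΦ, H3⟩ := H2 F γ hFL hγ hγle
  refine ⟨Φ, hΦ0, hΦ, fun J => ?_⟩
  obtain ⟨c, R, a, hId, hRep, hA⟩ := H3 J (J + 1) (Nat.le_succ J)
  have h1 : J + 1 - J = 1 := by omega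
  refine ⟨c, R 0, a 0, fun U hU => ?_, ?_, ?_⟩
  · have := hId U hU
    rw [h1, Finset.sum_range_one] at this
    exact this
  · have := hRep 0 (by rw [h1]; exact Finset.mem_range.2 one_pos)
    exact this
  · have := hA 0 (by rw [h1]; exact Finset.mem_range.2 one_pos)
    simpa using this


/-- **REP ⇒ RUNG 1 (PROVED, v4)**: the rung is REP's instance `K := J + 1`. [cite: Balaban1985UV3, (25)-(37) pp.262-265] -/
theorem loopLedgerDepthOne_of_rep (h : BeyondOneLoopRepCan) : LoopLedgerDepthOneCan := by
  intro L
  obtain ⟨pS, H⟩ := h L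
  refine ⟨pS, fun b₀ p₀ hb hp hp0 => ?_⟩
  obtain ⟨ε₁, hε₁, H1⟩ := H b₀ p₀ hb hp hp0
  refine ⟨ε₁, hε₁, fun ε₀ hε₀ hε₀le => ?_⟩
  obtain ⟨γ₁, hγ₁, κ, hκ, H2⟩ := H1 ε₀ hε₀ hε₀le
  refine ⟨γ₁, hγ₁, κ, hκ, fun F γ hFL hγ hγle => ?_⟩
  obtain ⟨Φ, hΦ0, hΦ, H3⟩ := H2 F γ hFL hγ hγle
  exact ⟨Φ, hΦ0, hΦ, fun J => H3 J (J + 1) (Nat.le_succ J)⟩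

end RungOne

/-! ## §3d (v6) THE GAS DOOR (count-neutral, PROVED knits): REP and RUNG 1 in print's RAW cluster-expansion format — «the beyond-one-loop part of the fluctuation at
the physical coupling is, ON THE WINDOW and up to a constant, the LOGARITHM OF A KOTECKÝ–PREISS GAS of V-local field-dependent activities with one-bond size
`≤ Φ J`» ([Balaban1987RG1] (0.26) / [Balaban1989LargeFieldII] (1.90), (1.97): the exponentiated cluster expansion BEFORE the logarithm is taken) — and the PROVED
implications GAS ⇒ REP, GAS₁ ⇒ RUNG 1 through KPL.  The two formats carry the same wall (re-exponentiation `exp Σ_X E(X) = Π_X (1 + (e^{E(X)} − 1))` goes back, with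
norm loss); the organ hand takes whichever door its expansion produces: a one-step cluster expansion of the constrained fluctuation integral ([Balaban1985UV3] §A)
lands in GAS₁ natively, the multi-step inductive effective action ([Balaban1987RG1] (0.23)) in REP. -/

section GasDoor

/-- **GAS · REP IN GAS FORMAT** (a def, NOT a stub; the organ's alternative door): REP's quantifier prefix VERBATIM, and at every depth `J ≤ K` a constant `c` and
a V-local real activity `w` on the bond polymers of `(F.P J)₀` forming a Kotecký–Preiss gas on the `θ_J`-window at rate `κ` with one-bond size `≤ Φ J`, such that
ON THE WINDOW `f¹_{J,K} = c + F₀ + log Ξ(w_·)`. [cite: Balaban1987RG1, (0.22)-(0.26) pp.256-257; Balaban1989LargeFieldII, (1.90) p.388, (1.97) p.389; Balaban1985UV3, (41)-(47) pp.266-267] -/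
def BeyondOneLoopGasCan : Prop :=
  ∀ (L : ℕ), ∃ pS : ℝ, ∀ (b₀ p₀ : ℝ), 0 < b₀ → pS ≤ p₀ → 0 < p₀ → ∃ ε₁ : ℝ, 0 < ε₁ ∧ ∀ (ε₀ : ℝ), 0 < ε₀ → ε₀ ≤ ε₁ →
    ∃ γ₁ : ℝ, 0 < γ₁ ∧ ∃ κ : ℝ, 0 < κ ∧
      ∀ (F : T3Family) (γ : ℝ), F.L = L → 0 < γ → γ ≤ γ₁ →
        ∃ Φ : ℕ → ℝ, (∀ J, 0 ≤ Φ J) ∧ Tendsto (fun J : ℕ => (J : ℝ) * Φ J) atTop (𝓝 0) ∧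
          ∀ (J K : ℕ) (hJK : J ≤ K),
            ∃ (c : ℝ) (w : GaugeField (F.P J) 0 (Matrix.specialUnitaryGroup (Fin 2) ℂ) → Finset (PBond (F.P J) 0) → ℝ),
              KPGasOn {U | PlaqSmall (θBal F.L γ b₀ p₀ J) U} κ (Φ J) w ∧
              ∀ U : GaugeField (F.P J) 0 (Matrix.specialUnitaryGroup (Fin 2) ℂ), PlaqSmall (θBal F.L γ b₀ p₀ J) U →
                fluctAtCan F γ b₀ p₀ ε₀ hJK 1 U = c + oneLoopPartCan F γ b₀ p₀ ε₀ hJK U + Real.log (gasZ w U)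

/-- **KPL ⇒ GAS ⇒ REP (PROVED)**: `R := log Ξ(w_·)`, `a := Φ J`; KPL represents `R` on the window. [cite: Balaban1989LargeFieldII, (1.98)-(1.99) p.390] -/
theorem beyondOneLoopRep_of_gas (hK : KPLogRep) (hG : BeyondOneLoopGasCan) : BeyondOneLoopRepCan := by
  intro L
  obtain ⟨pS, H⟩ := hG L
  refine ⟨pS, fun b₀ p₀ hb hp hp0 => ?_⟩
  obtain ⟨ε₁, hε₁, H1⟩ := H b₀ p₀ hb hp hp0
  refine ⟨ε₁, hε₁, fun ε₀ hε₀ hε₀le => ?_⟩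
  obtain ⟨γ₁, hγ₁, κ, hκ, H2⟩ := H1 ε₀ hε₀ hε₀le
  refine ⟨γ₁, hγ₁, κ, hκ, fun F γ hFL hγ hγle => ?_⟩
  obtain ⟨Φ, hΦ0, hΦ, H3⟩ := H2 F γ hFL hγ hγle
  refine ⟨Φ, hΦ0, hΦ, fun J K hJK => ?_⟩
  obtain ⟨c, w, hgas, hid⟩ := H3 J K hJK
  exact ⟨c, fun U => Real.log (gasZ w U), Φ J, hid, hK (F.P J) {U | PlaqSmall (θBal F.L γ b₀ p₀ J) U} κ (Φ J) hκ.le w hgas, le_rfl⟩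

/-- **GAS₁ · RUNG 1 IN GAS FORMAT** (the hands' natural entry signature for ONE constrained fluctuation integral: `K := J+1`; a def, NOT a stub): ON THE WINDOW
`f¹_{J,J+1} = c + F₀ + log Ξ(w_·)` with `w` a Kotecký–Preiss gas at rate `κ` of one-bond size `≤ Φ J`, `J·Φ J → 0` — print's one-step format: Gaussian
normalisation (in `c` and `F₀`) times the exponentiated cluster expansion of the non-Gaussian perturbation in the unit-gap background.
[cite: Balaban1985UV3, (25)-(37) pp.262-265; Balaban1987RG1, (0.26) p.257] -/
def LoopLedgerDepthOneGasCan : Prop :=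
  ∀ (L : ℕ), ∃ pS : ℝ, ∀ (b₀ p₀ : ℝ), 0 < b₀ → pS ≤ p₀ → 0 < p₀ → ∃ ε₁ : ℝ, 0 < ε₁ ∧ ∀ (ε₀ : ℝ), 0 < ε₀ → ε₀ ≤ ε₁ →
    ∃ γ₁ : ℝ, 0 < γ₁ ∧ ∃ κ : ℝ, 0 < κ ∧
      ∀ (F : T3Family) (γ : ℝ), F.L = L → 0 < γ → γ ≤ γ₁ →
        ∃ Φ : ℕ → ℝ, (∀ J, 0 ≤ Φ J) ∧ Tendsto (fun J : ℕ => (J : ℝ) * Φ J) atTop (𝓝 0) ∧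
          ∀ (J : ℕ),
            ∃ (c : ℝ) (w : GaugeField (F.P J) 0 (Matrix.specialUnitaryGroup (Fin 2) ℂ) → Finset (PBond (F.P J) 0) → ℝ),
              KPGasOn {U | PlaqSmall (θBal F.L γ b₀ p₀ J) U} κ (Φ J) w ∧
              ∀ U : GaugeField (F.P J) 0 (Matrix.specialUnitaryGroup (Fin 2) ℂ), PlaqSmall (θBal F.L γ b₀ p₀ J) U →
                fluctAtCan F γ b₀ p₀ ε₀ (Nat.le_succ J) 1 U = c + oneLoopPartCan F γ b₀ p₀ ε₀ (Nat.le_succ J) U + Real.log (gasZ w U)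

/-- **KPL ⇒ GAS₁ ⇒ RUNG 1 (PROVED)**. [cite: Balaban1985UV3, (25)-(37) pp.262-265] -/
theorem loopLedgerDepthOne_of_gas (hK : KPLogRep) (hG : LoopLedgerDepthOneGasCan) : LoopLedgerDepthOneCan := by
  intro L
  obtain ⟨pS, H⟩ := hG L
  refine ⟨pS, fun b₀ p₀ hb hp hp0 => ?_⟩
  obtain ⟨ε₁, hε₁, H1⟩ := H b₀ p₀ hb hp hp0
  refine ⟨ε₁, hε₁, fun ε₀ hε₀ hε₀le => ?_⟩
  obtain ⟨γ₁, hγ₁, κ, hκ, H2⟩ := H1 ε₀ hε₀ hε₀le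
  refine ⟨γ₁, hγ₁, κ, hκ, fun F γ hFL hγ hγle => ?_⟩
  obtain ⟨Φ, hΦ0, hΦ, H3⟩ := H2 F γ hFL hγ hγle
  refine ⟨Φ, hΦ0, hΦ, fun J => ?_⟩
  obtain ⟨c, w, hgas, hid⟩ := H3 J
  exact ⟨c, fun U => Real.log (gasZ w U), Φ J, hid, hK (F.P J) {U | PlaqSmall (θBal F.L γ b₀ p₀ J) U} κ (Φ J) hκ.le w hgas, le_rfl⟩

/-- **GAS ⇒ GAS₁ (PROVED)**: specialise to `K := J + 1`. [cite: Balaban1985UV3, (25)-(37) pp.262-265] -/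
theorem loopLedgerDepthOneGas_of_gas (hG : BeyondOneLoopGasCan) : LoopLedgerDepthOneGasCan := by
  intro L
  obtain ⟨pS, H⟩ := hG L
  refine ⟨pS, fun b₀ p₀ hb hp hp0 => ?_⟩
  obtain ⟨ε₁, hε₁, H1⟩ := H b₀ p₀ hb hp hp0
  refine ⟨ε₁, hε₁, fun ε₀ hε₀ hε₀le => ?_⟩
  obtain ⟨γ₁, hγ₁, κ, hκ, H2⟩ := H1 ε₀ hε₀ hε₀le
  refine ⟨γ₁, hγ₁, κ, hκ, fun F γ hFL hγ hγle => ?_⟩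
  obtain ⟨Φ, hΦ0, hΦ, H3⟩ := H2 F γ hFL hγ hγle
  exact ⟨Φ, hΦ0, hΦ, fun J => H3 J (J + 1) (Nat.le_succ J)⟩

/-- **H4ᶜ THROUGH THE GAS DOOR (PROVED)**: `SCL → KPL → GAS → H4ᶜ`. [cite: Balaban1987RG1, (0.22)-(0.26) pp.256-257] -/
theorem beyondOneLoopSmallCan_of_gas (hS : SemiclassicalLimitCan) (hK : KPLogRep) (hG : BeyondOneLoopGasCan) : BeyondOneLoopSmallCan :=
  beyondOneLoopSmallCan_of_rep hS (beyondOneLoopRep_of_gas hK hG)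

/-- **GAS ⇒ REP, unconditionally (PROVED, KPL by name)**. [cite: Balaban1989LargeFieldII, (1.98)-(1.99) p.390] -/
theorem beyondOneLoopRep_of_gas' (hG : BeyondOneLoopGasCan) : BeyondOneLoopRepCan :=
  beyondOneLoopRep_of_gas kpLogRep_closed hG

/-- **GAS₁ ⇒ RUNG 1, unconditionally (PROVED, KPL by name)**. [cite: Balaban1985UV3, (25)-(37) pp.262-265] -/
theorem loopLedgerDepthOne_of_gas' (hG : LoopLedgerDepthOneGasCan) : LoopLedgerDepthOneCan :=
  loopLedgerDepthOne_of_gas kpLogRep_closed hG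

/-- **SCL → GAS → H4ᶜ, unconditionally in KPL (PROVED)**. [cite: Balaban1987RG1, (0.22)-(0.26) pp.256-257] -/
theorem beyondOneLoopSmallCan_of_gas' (hS : SemiclassicalLimitCan) (hG : BeyondOneLoopGasCan) : BeyondOneLoopSmallCan :=
  beyondOneLoopSmallCan_of_gas hS kpLogRep_closed hG

end GasDoor

/-! ## §4 Registered stubs and the delivered theorem (v2: SCL retired as a stub — proved in §3b from EXW, GAP♯; v4: the organ stub is REP = LEDGER₀, LEDGER's collapse) -/

section Stubs

/-- EXW stub — organ of LINE g18-1 (`semiclassical_s2beta.lean` §3, G-K1aR-2; LEAD's T8 seats), restated token-identically; keyed and COUNTED THERE, not in this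
line's books. [cite: Balaban1985Variational, Thm 1 (8) p.279] -/
theorem stub_windowExactness : WindowExactness := by
  sorry

/-- GAP♯ stub — organ of LINE g18-1 (`semiclassical_s2beta.lean` §3, the stiffness seats + the uniqueness half of CMP 102 Thm 1), restated token-identically;
keyed and COUNTED THERE. [cite: Balaban1985Variational, Thm 1 (8)-(10) p.279 and (142) p.299] -/
theorem stub_uniformFibreGapOrbit : UniformFibreGapOrbit := by
  sorry

/-- REP stub (= LEDGER₀; v4, critic #368 P1 option (a)) — THIS LINE's organ (XL): ONE small V-local polymer representation of the beyond-one-loop part of the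
physical-coupling fluctuation part on the window, depth-uniform.  The per-step LEDGER is the print format in which a Bałaban-style proof delivers it (collapse
PROVED: `beyondOneLoopRep_of_loopLedgerCan`).  First rung: `LoopLedgerDepthOneCan` (= REP at `K = J+1`, `loopLedgerDepthOne_of_rep`).
[cite: Balaban1987RG1, (0.22)-(0.26) pp.256-257; Balaban1985UV3, (41)-(47) pp.266-267; Balaban1988Convergent, Thm 1] -/
theorem stub_beyondOneLoopRepCan : BeyondOneLoopRepCan := by
  sorry

/-- **H4ᶜ DELIVERED BY NAME** from the stubs (v4: EXW, GAP♯, REP; SCL by `semiclassicalLimitCan_of_organs`). [cite: Balaban1985UV3, (45)-(47) p.267] -/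
theorem beyondOneLoopSmallCan_of_stubs : BeyondOneLoopSmallCan :=
  beyondOneLoopSmallCan_of_rep (semiclassicalLimitCan_of_organs stub_windowExactness stub_uniformFibreGapOrbit) stub_beyondOneLoopRepCan

end Stubs

end Summit.QuantumFields.YangMills.Cruxes.FluctuationComparisonRegPrIntL.RunPairOrgan.LoopLedger
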